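/-
Copyright: public-audit package `pub-balaban` (b2b-balaban), seat pv09-g6. Released under Apache 2.0 like Mathlib.
-/
import Mathlib
import Literature.MathematicalPhysics.QuantumFieldTheory.Balaban1983to89.B6LowerBound2153Torus
import Literature.MathematicalPhysics.QuantumFieldTheory.Balaban1983to89.B6BondEliminationTorus

/-!
# B6 (2.152)–(2.157) END-TO-END on the whole torus T^(k) for the concrete (1.66) form: the torus average Q, the
periodic elimination matrix C of p. 250, (2.153) and [3] discharged — modulo the decay of Δ_k; v1.1 (§7): THE matrix
of the (1.66) form by polarization, so that the decay of its kernel is the ONLY hypothesis left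

Source under audit: T. Bałaban, *Propagators and renormalization transformations for lattice gauge theories. II*,
Commun. Math. Phys. **96** (1984) 223–250 [B6], (2.152)–(2.157) pp. 249–250; with *… I*, Commun. Math. Phys. **95**
(1984) 17–40 [B5], (1.66)–(1.67) p. 29, and [3] = T. Bałaban, *Regularity and decay of lattice Green's functions*,
Commun. Math. Phys. **89** (1983) 571–597 [B4], Sect. 5.  Quotations read by this seat from the ×2 page renders
`run/shared/lean/pub/pub-balaban/b2b-balaban-ref1/pages/1984-cmp96-propagators-rt-II/…-p027-x2.png` (p. 249) and
`…-p028-x2.png` (p. 250) (journal page = PDF page + 222), not from an OCR layer.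

CITATION HEADER (lean-in-tree rule).  Cell `pub-balaban`, unit `b2b-balaban-pv09-g6` (surge node prover #09, gen 6;
journal claim G-B6-2156-TORUS-CONCRETE, self-assigned under the yield clause).  Siblings imported, none edited:
`…B6LowerBound2153Torus` (this lineage, gen 5: (2.153) on the whole torus for the (1.66) form,
`lowerBound2153_lattice`; the dictionary `toT`/`rep`/`lift` between the box ∏[0, M_i) ⊂ Z^d and
`Tor M = Π_μ ZMod (M μ)`), `…B6BondEliminationTorus` (this lineage, gen 4: the periodic distance `pdist`, the periodic
frame `zdPer`, `Separated`/`box_separated`, and Sect. 5 of [3] on tori for sub-family reductions, `subReductions_per`,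
PROVED); through them `…B6BondElimination` (unit b06-g3: `SubReduction`, `.cov` = (2.156), pivots `pivSite`/`cOf`,
multiplicities `hits`/`mult` with `mult_pivSite`, `cOf_eq_of_mult_ne_zero`, `dist_le_of_mult_ne_zero`, the tree
predicate `IsTree`/`isTree_iff`, the remaining variables `freeB`), `…B6Lemma24Torus` (gen 5: `pbox`, `wrap`,
`coarseSites`, `faces`, `block_subset_pbox`), `…B6Lemma24PrintedShape` (b06-g6: (Q₁B)(c) verbatim, `q1`),
`…B5Bounds167Lattice` (pv15 lineage: `formDk n M` = the third expression of (1.66), `ofRealCfg`),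
`…B6Elimination` (b06-g2: `block`, `corner`) and `…B4Sect5Torus` (gen 4: `tdist`).

## What is printed (verbatim)

* [B6] p. 249: *"Doing a k + 1 renormalization transformation we have to calculate an integral of the form
  const ∫dB δ(QB) δ_{Ax}(B) e^{−½⟨B,Δ_kB⟩} F(B)  (1.152) [sic: (2.152)]  on the whole lattice T^{(k)}, or on a subset
  Λ ⊂ T^{(k)}. Using (2.118) and (2.128) we get  ⟨B, Δ_kB⟩ ≥ (γ₀/12d²)L^{−d−1}‖B‖²,  or  Δ_k ≥ (γ₀/12d²)L^{−d−1}
  (2.153)  on the subspace of B satisfying: QB = 0, B(Γ_{y,x}) = 0 for x ∈ B(y). Let us denote the covariance of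
  the Gaussian integration in (2.152) by C^{(k)}, or by C^{(k)}_Λ, hence  ∫dB↾_Λ δ(QB) δ_{Ax}(B)
  e^{−½⟨B,Δ_kB⟩+⟨J,B⟩} = Z^{(k)} e^{½⟨J,C^{(k)}_Λ J⟩}.  (2.154)  An easy way to get a useful representation for
  C^{(k)}_Λ is to get rid of the unnecessary variables in the integral above. We remove the variables B_b for
  b ⊂ Γ_{y,x} using the δ-functions δ_{Ax}(B). Next we remove the variables B_{b₀}, where b₀ is a bond belonging to
  B(c) for some c ∈ Λ′, and contained in c, using the δ-functions δ((QB)(c)). If we denote the remaining variables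
  by B′, then we can write B = CB′, where C is a linear"* [p. 250:] *"operator, and we have  (the left-hand side of
  (2.154)) = (L^d)^{|Λ′|} ∫dB′ e^{−½⟨B′,C*Δ_kCB′⟩+⟨C*J,B′⟩} = (L^d)^{|Λ′|} Z′^{(k)} e^{½⟨C*J,(C*Δ_kC)^{−1}C*J⟩},
  (2.155)  hence  C^{(k)}_Λ = C(C*Δ_kC)^{−1}C*.  (2.156)  By the definition of C we have of course that CB′ = 0
  outside Λ, QCB′ = 0, (CB′)(Γ_{y,x}) = 0, x ∈ B(y), y ∈ Λ′, for arbitrary B′. The inequality (2.153) implies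
  ⟨B′, C*Δ_kCB′⟩ ≥ (γ₀/12d²)L^{−d−1}‖CB′‖² ≥ γ′₀‖B′‖²,  (2.157)  where γ′₀ = (γ₀/12d²)L^{−d−1}. C is a short-ranged
  operator, so C*Δ_kC has the same exponential decay as Δ_k. Now we may apply the theory developed in Sect. 5 of [3]
  on unit lattice operators. It gives us an exponential decay, and all the other properties, for the operator
  (C*Δ_kC)^{−1}, hence for C^{(k)}_Λ also."*

## Why this node: the torus average wraps (a seam-fidelity point about this lineage's gen-4 instance)

On the WHOLE lattice T^{(k)} = Z^d/(M₁Z × ⋯ × M_dZ) (M_i = L · #blocks, L ∣ M_i) the constraint δ(QB) of (2.152) is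
the block average OF THE TORUS: (QB)(c) = Σ_{x∈B(c₋)} L^{−(d+1)} B([x, x + Le_μ]) sums the torus bonds of the straight
contour [x, x + Le_μ], and for x in the last block layer of the direction μ that contour WRAPS through the seam of any
box of representatives ∏[0, M_i).  `…B6BondEliminationTorus.bond250_torus` (gen 4) is a correct theorem as typed —
∀ separated region Ω₀ of representatives, ∀ admissible constraint data (K, Y), with (QB)(c) :=
`B6BondElimination.avgQ` (contours read in Z^d, B extended by ZERO off Ω₀) — and (2.153) enters it as the HYPOTHESIS
`LowerOnConstrained` for that average.  Its instance "Ω₀ = the box, K = all faces of the torus" therefore imposes, at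
the faces of the last layers, a TRUNCATED average, not the torus average of the print; and (2.153) as PROVED on the
torus (`…B6LowerBound2153Torus.lowerBound2153_lattice`, gen 5: Lemma 2.4 on T + (1.67)) lives on the subspace cut out
by the TORUS averages, so it cannot discharge that hypothesis for that instance.  This file supplies the instance
faithful to (2.152) on T^{(k)}: the torus average written on the box through the reduction `wrap` (§§2–3), the
elimination matrix C of p. 250 built from it (§4), (2.153) for it DISCHARGED (§5), and the chain to the decay of
C^{(k)} (§6).  Nothing of gen 4 or gen 5 is edited; the Z^d-average theorems keep their meaning for regions on which
no averaging contour leaves the region.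

## What this file proves (kernel-checked, no `sorry`; axioms ⊆ {propext, Classical.choice, Quot.sound})

* §2 `hitsP`/`multP L M c z ν`: the PERIODIC multiplicity with which the torus bond ⟨z, z + e_ν⟩ (z in the box)
  occurs in L^{d+1}(Q₁B)(c) — pairs (x, s), x ∈ B(c₋), 0 ≤ s < L, with `wrap M (x + se_μ) = z`.  For the faces c of
  the torus (`faces L M`, L ∣ M_i): the pivot b₀(c) = ⟨c₋ + (L−1)e_μ, c₋ + Le_μ⟩ has multiplicity L
  (`multP_pivSite`; weight L·L^{−(d+1)} = L^{−d}, the Jacobian (L^d)^{|Λ′|} of (2.155)); pivots are PRIVATE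
  (`cOf_eq_of_multP_ne_zero`: b₀(c′) occurs in (Q₁B)(c) only for c′ = c — proved from the Z^d statement of unit
  b06-g3 at a period translate, two box points congruent mod M being equal); RANGE ρ_M(b₀(c)₋, z) ≤ L − 1 in the
  periodic distance (`pdist_le_of_multP_ne_zero`); COLUMN count Σ_{c} multP_c(z,ν) ≤ L (`sum_multP_le_L`) and ROW
  count Σ_b multP_c(b) ≤ L^d·L (`sum_multP_le`).
* §3 the periodic extension `perExt M B : Cfg d` of a field on the box variables (= `lift M (ofBox M B)`,
  `lift_ofBox`; M-periodic, `isPeriodic_perExt`), and **(Q₁B^per)(c) = L^{−(d+1)} Σ_b multP_c(b) B(b)**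
  (`q1_perExt_eq_sum_multP`) with (Q₁·)(c) VERBATIM from (2.125) (`B6Lemma24PrintedShape.q1`).
* §4 THE ELIMINATION MATRIX C OF p. 250 ON THE TORUS, `elimT L M : Matrix (box bonds) (remaining bonds) ℝ` —
  remaining variables `freeT` = all torus bonds minus the pivots of all faces minus the tree bonds Γ_{y,x} of all
  blocks (`B6BondElimination.freeB` over the box: blocks and trees do not wrap); a remaining variable is copied, a
  tree bond set to 0, a pivot row = −multP/L.  PROVED: *"QCB′ = 0"* with the torus average (`q1_elimT_mulVec`),
  *"(CB′)(Γ_{y,x}) = 0 … for arbitrary B′"* (`elimT_mulVec_tree`), C is ONTO the constrained subspace with the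
  coordinate projection as inverse (`elimT_restrT`), ‖CB′‖ ≥ ‖B′‖ (`elimT_iso`, second inequality of (2.157)),
  *"C is a short-ranged operator"*: range ≤ L − 1 in ρ_M (`elimT_range`), ℓ¹ column sums ≤ 2 (`elimT_col`), row sums
  ≤ L^d (`elimT_row`).  (Transcription of `B6BondElimination` §§4–5 with `mult ↦ multP`.)
* §5 `LowerOnConstrainedT L M Δ γ` = the shape of (2.153) on the torus (torus averages, all trees), and its
  DISCHARGE `lowerOnConstrainedT_of_represents`: for d ≥ 2, L ≥ 1, n ≥ 1, L ∣ M_i and every Δ with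
  ⟨B, ΔB⟩ = `formDk n M` of B (`Represents M n Δ`), (2.153) holds with γ = `gamma2153 d L` =
  ((4/π²)^{d+2}/(12d²))·L^{−(d+1)} — `B6LowerBound2153Torus.lowerBound2153_lattice` BY NAME through the dictionary
  (trees: `B6BondElimination.isTree_iff`).
* §6 `bondReductionT L M Δ : SubReduction d d` (Ω = box, kept = `freeT`, C = `elimT`; `.cov` = C(C*ΔC)⁻¹C* literally,
  `bondReductionT_cov`), its printed-shape inputs in ρ_M (`bondReductionT_printedPer`: range L − 1, ℓ¹ ≤ L^d + 1, the
  first inequality of (2.157) = (2.153) at B = CB′), `bond250_torusT` (ONE (c, δ) for all tori and all symmetric Δ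
  with ρ_M-decay and (2.153)_T, via `subReductions_per` + `box_separated`), and the END-TO-END theorem
  **`cov2156_torus`**: d ≥ 2, L ≥ 1, c₀, δ₀ > 0 ⟹ ∃ c, δ > 0 ∀ tori M (L ∣ M_i) ∀ n ≥ 1 ∀ symmetric Δ representing
  the (1.66) form at level n with |Δ(b,b′)| ≤ c₀e^{−δ₀ρ_M(b₋,b′₋)}:  |C^{(k)}(b,b′)| ≤ c·e^{−δρ_M(b₋,b′₋)} for the
  covariance (2.156) of (2.152) on the whole lattice with the explicit C.  Every printed input of the p. 249–250
  chain except the decay of Δ_k is a theorem here or upstream: (2.128) on T (`B6Lemma24Torus.lemma24_torus`),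
  (2.118) = (1.67) (`B5Bounds167Lattice.ineq167`), (2.153), (2.157), Sect. 5 of [3] on tori
  (`B6BondEliminationTorus.engine_per`).
* v1.1 (append-only, §7 — POLARIZATION): the matrix of the (1.66) form in the bond basis of the torus is CONSTRUCTED,
  `deltaPol M n` (Δ(b,b′) = Σ_{(μ,ν,p′)} ½w166(p′)·Re(conj φ_{μνp′}(e_b)·φ_{μνp′}(e_{b′})), φ = `B5Bounds167Lattice.curlHat`
  of the field read on `Tor M`, ℝ-linear: `phiC_add`, `phiC_smul`, `phiC_eq_sum`), and PROVED symmetric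
  (`deltaPol_isSymm`), representing (`represents_deltaPol : Represents M n (deltaPol M n)`, from the abstract identity
  `polarize`) and UNIQUE among symmetric representing matrices (`eq_deltaPol_of_represents`, from `eq_of_quad_eq`: a
  symmetric real matrix is determined by its quadratic form); the residual hypothesis is NAMED, `KernelDecay M n c₀ δ₀`
  (:= |deltaPol M n (b,b′)| ≤ c₀e^{−δ₀ρ_M(b₋,b′₋)}), and the end-to-end theorem is restated with it as the ONLY
  hypothesis besides d ≥ 2, L ≥ 1, L ∣ M_i, n ≥ 1: **`cov2156_torus_deltaPol`**.

## HONEST SCOPE (what is NOT claimed)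

(i) THE DECAY OF Δ_k IS A HYPOTHESIS (`hdec` of `cov2156_torus`; `hd` of `bond250_torusT`; named `KernelDecay` for the
explicit matrix in §7, v1.1): p. 250 presupposes it
(*"C*Δ_kC has the same exponential decay as Δ_k"*); this seat found no numbered display of [B5]/[B6] asserting an
exponential bound for the kernel of the operator of (1.66), and does not prove one (it would follow from analyticity
of the symbol of (1.66) in a strip, not formalised for these objects).  (ii) `Represents M n Δ` takes Δ to be ANY
symmetric matrix on the torus bond variables whose quadratic form is `formDk n M` (the third expression of (1.66)) of
the field read on `Tor M × Fin d`; v1 did not construct such a Δ — v1.1 §7 DOES (`deltaPol`, `represents_deltaPol`,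
unique by `eq_deltaPol_of_represents`), so from v1.1 the theorems are about ONE operator per (n, torus), the matrix of
the (1.66) form; what stays NOT certified, package-wide, is the identity of the (1.66) form with (1.65) ⟨∂H_kB, ∂H_kB⟩
(`…B5Bounds167Lattice` header).  (iii) Only the exponential decay of C^{(k)} is transported;
*"all the other properties"* of (C*Δ_kC)^{−1} and the normalisation factors (L^d)^{|Λ′|}, Z′^{(k)} of (2.155) are not
formalised.  (iv) Only the case *"on the whole lattice T^{(k)}"*: the subset case *"or on a subset Λ ⊂ T^{(k)}"*
((2.154) with B↾Λ, *"CB′ = 0 outside Λ"*) is not treated in this file (`…B6BondEliminationTorus.bond250_torus` treats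
separated regions of representatives with the Z^d average and zero extension, faithful where no averaging contour of
a constraint in K leaves the region; `…B6LowerBound2153Torus` §7 has (2.153) for B = 0 outside Λ).  (v) d ≥ 2 for
§§5–6's discharge (no plaquettes in d = 1), L ≥ 1, all M_i ≥ 1 with L ∣ M_i; "QB = 0" is read as (Q₁B)(c) = 0 with Q₁
from (2.125) (= the B5 (1.11)/(1.18) average at k = 1), "B(Γ_{y,x}) = 0" as `B6BondElimination.IsTree` on every block
(= the bonds of ⋃_x Γ_{y,x}, `isTree_iff`).  (vi) Value = kernel certificate of the printed bookkeeping on the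
carrier it is printed for; NOT summit progress.

DIVERGENCES: none new (the label "(1.152)" for (2.152) on p. 249, sic, is cell divergence D-b06.9).
-/

open Finset Matrix

namespace Literature.MathematicalPhysics.QuantumFieldTheory.Balaban1983to89.B6Cov2156Torus

open B6Elimination (corner mem_block mem_block_corner_iff corner_eq_self_of_dvd card_block)
open B6BondElimination (unitVec unitVec_apply add_smul_unitVec_apply sub_smul_unitVec_apply pivSite cOf pivSite_apply
  cOf_fst_apply cOf_snd pivSite_cOf cOf_pivSite eq_of_cOf_eq hits mem_hits mult mult_pivSite cOf_eq_of_mult_ne_zero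
  dist_le_of_mult_ne_zero sum_idx_ite_le_one IsTree not_isTree_of_piv treeBonds mem_treeBonds isTree_iff freeB
  mem_freeB SubReduction)
open B6TreeGaugePoincare (Cfg)
open B6Lemma24PrintedShape (q1 segSum)
open B6Lemma24Torus (IsPeriod IsPeriodic pbox mem_pbox coarseSites mem_coarseSites coarseSites_dvd faces mem_faces
  wrap wrap_mem_pbox isPeriod_sub_wrap wrap_eq_self wrap_congr wrap_wrap_add block_subset_pbox)
open B6BondEliminationTorus (res pdist pdist_le_dist zdPer Separated box_separated PrintedPer subReductions_per)
open B6LowerBound2153Torus (toT rep rep_mem_pbox rep_toT toT_rep rep_toT_eq_wrap lift lift_apply isPeriodic_lift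
  lowerBound2153_lattice pos_of_neZero)
open B5Prop11Plancherel (Tor)
open B5Bounds167Lattice (ofRealCfg formDk)

noncomputable section

variable {d : ℕ} {L : ℕ} {M : Fin d → ℕ}

/-! ## §1  Small lemmas on the box ∏[0, M_i) and the period lattice -/

/-- A period vector with all coordinates of absolute value < M_i is 0. [folklore] -/
theorem eq_zero_of_isPeriod_of_lt {v : Fin d → ℤ} (hv : IsPeriod M v) (h : ∀ i, |v i| < (M i : ℤ)) : v = 0 := by
  funext i
  exact Int.eq_zero_of_abs_lt_dvd (hv i) (h i)

/-- Two points of the box congruent mod M are equal. [folklore] -/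
theorem eq_of_mem_pbox_of_isPeriod {x x' : Fin d → ℤ} (hx : x ∈ pbox M) (hx' : x' ∈ pbox M)
    (h : IsPeriod M (x - x')) : x = x' := by
  rw [← wrap_eq_self hx, ← wrap_eq_self hx']
  exact wrap_congr fun i => by simpa using h i

/-- L ∣ M_i and M_i ≥ 1 give L ≤ M_i. [folklore] -/
theorem le_of_dvd_M (hM : ∀ i, 0 < M i) (hLM : ∀ i, L ∣ M i) (i : Fin d) : (L : ℤ) ≤ (M i : ℤ) := by
  exact_mod_cast Nat.le_of_dvd (hM i) (hLM i)

/-- The pivot site b₀(c)₋ = c₋ + (L−1)e_μ lies in the block B(c₋). [folklore] -/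
theorem pivSite_mem_block (hL : 0 < L) (c : (Fin d → ℤ) × Fin d) : pivSite L c ∈ B6Elimination.block L c.1 := by
  rw [mem_block]
  intro i
  rw [pivSite_apply]
  have hL1 : (1 : ℤ) ≤ L := by exact_mod_cast hL
  split_ifs <;> constructor <;> omega

/-- c₋ ∈ LZ^d for a face c of the torus. [folklore] -/
theorem faces_dvd {c : (Fin d → ℤ) × Fin d} (hc : c ∈ faces L M) : ∀ i, (L : ℤ) ∣ c.1 i :=
  coarseSites_dvd _ (mem_faces.1 hc)

/-- The pivot of a face of the torus starts in the box (L ∣ M_i). [folklore] -/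
theorem pivSite_mem_pbox (hL : 0 < L) (hLM : ∀ i, L ∣ M i) {c : (Fin d → ℤ) × Fin d} (hc : c ∈ faces L M) :
    pivSite L c ∈ pbox M :=
  block_subset_pbox hLM (mem_faces.1 hc) (pivSite_mem_block hL c)

/-- The residue class of a point is that of its reduction into the box. [folklore] -/
theorem res_wrap (hM : ∀ i, 1 ≤ M i) (z : Fin d → ℤ) : res M hM (wrap M z) = res M hM z := by
  funext i
  apply Fin.ext
  show ((wrap M z) i % (M i : ℤ)).toNat = (z i % (M i : ℤ)).toNat
  congr 1
  show z i % (M i : ℤ) % (M i : ℤ) = z i % (M i : ℤ)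
  exact Int.emod_emod_of_dvd _ dvd_rfl

/-- ρ_M(x, wrap z) = ρ_M(x, z). [folklore] -/
theorem pdist_wrap_right (hM : ∀ i, 1 ≤ M i) (x z : Fin d → ℤ) : pdist M hM x (wrap M z) = pdist M hM x z := by
  unfold pdist
  rw [res_wrap]

/-! ## §2  The averaging (1.11)/(2.125) ON THE TORUS, written on the box: periodic multiplicities

On the torus T = Z^d/(M₁Z × ⋯ × M_dZ) (L ∣ M_i) the straight contour [x, x + Le_μ] of (Q₁B)(c), x ∈ B(c₋), consists
of the unit bonds ⟨x + se_μ, x + (s+1)e_μ⟩, s = 0, …, L − 1, OF THE TORUS; recorded by representatives in the box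
∏[0, M_i) the bond ⟨x + se_μ, ·⟩ is the variable attached to `wrap M (x + se_μ)` — for x in the last block layer of
the direction μ these bonds WRAP across the seam of the box.  `multP` counts the pairs (x, s) of the double sum whose
bond is a given variable; it replaces `B6BondElimination.mult` (contours read in Z^d, no wrapping). -/

/-- The pairs (x, s), x ∈ B(c₋), 0 ≤ s < L, of the double sum (1.11)/(2.125) whose unit bond, reduced into the box,
starts at z. [cite: Balaban1984PropagatorsII, (2.125) p.245] -/
def hitsP (L : ℕ) (M : Fin d → ℕ) (c : (Fin d → ℤ) × Fin d) (z : Fin d → ℤ) : Finset ((Fin d → ℤ) × ℕ) :=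
  (B6Elimination.block L c.1 ×ˢ Finset.range L).filter fun xs => wrap M (xs.1 + (xs.2 : ℤ) • unitVec c.2) = z

/-- Membership in `hitsP`. [folklore] -/
theorem mem_hitsP {c : (Fin d → ℤ) × Fin d} {z : Fin d → ℤ} {xs : (Fin d → ℤ) × ℕ} :
    xs ∈ hitsP L M c z ↔
      (xs.1 ∈ B6Elimination.block L c.1 ∧ xs.2 < L) ∧ wrap M (xs.1 + (xs.2 : ℤ) • unitVec c.2) = z := by
  simp only [hitsP, Finset.mem_filter, Finset.mem_product, Finset.mem_range]

/-- The PERIODIC multiplicity with which the variable ⟨z, z + e_ν⟩ (z in the box) occurs in L^{d+1}(Q₁B)(c) on the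
torus. [cite: Balaban1984PropagatorsII, (2.125) p.245] -/
def multP (L : ℕ) (M : Fin d → ℕ) (c : (Fin d → ℤ) × Fin d) (z : Fin d → ℤ) (ν : Fin d) : ℕ :=
  if ν = c.2 then (hitsP L M c z).card else 0

/-- For a face c of the torus, the pairs hitting the pivot are those of Z^d: a contour of B(c₋) passes through
b₀(c) on the torus only without wrapping (all coordinates differ from the pivot's by less than L ≤ M_i). [folklore] -/
theorem hitsP_pivSite (hL : 0 < L) (hM : ∀ i, 0 < M i) (hLM : ∀ i, L ∣ M i) {c : (Fin d → ℤ) × Fin d}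
    (hc : c ∈ faces L M) : hitsP L M c (pivSite L c) = hits L c (pivSite L c) := by
  ext ⟨x, s⟩
  rw [mem_hitsP, mem_hits]
  refine and_congr_right fun hxs => ?_
  obtain ⟨hx, hs⟩ := hxs
  constructor
  · intro h
    have hper : IsPeriod M ((x + (s : ℤ) • unitVec c.2) - pivSite L c) := by
      have h0 := isPeriod_sub_wrap (M := M) (x + (s : ℤ) • unitVec c.2)
      rwa [h] at h0
    have hzero := eq_zero_of_isPeriod_of_lt hper fun i => by
      rw [Pi.sub_apply, add_smul_unitVec_apply, pivSite_apply]
      obtain ⟨h1, h2⟩ := mem_block.1 hx i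
      dsimp only at h1 h2
      have h3 := le_of_dvd_M hM hLM i
      have hs' : (s : ℤ) < L := by exact_mod_cast hs
      have hs0 : (0 : ℤ) ≤ s := by positivity
      rw [abs_lt]
      split_ifs <;> constructor <;> omega
    exact sub_eq_zero.1 hzero
  · intro h
    rw [h]
    exact wrap_eq_self (pivSite_mem_pbox hL hLM hc)

/-- KERNEL-CHECKED: on the torus the pivot b₀(c) occurs in L^{d+1}(Q₁B)(c) with multiplicity L — the coefficient by
which δ((QB)(c)) is solved for B_{b₀(c)} (p. 249 *"we remove the variables B_{b₀} … using the δ-functions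
δ((QB)(c))"*). [cite: Balaban1984PropagatorsII, p.249] -/
theorem multP_pivSite (hL : 0 < L) (hM : ∀ i, 0 < M i) (hLM : ∀ i, L ∣ M i) {c : (Fin d → ℤ) × Fin d}
    (hc : c ∈ faces L M) : multP L M c (pivSite L c) c.2 = L := by
  have h := mult_pivSite hL c
  unfold mult at h
  unfold multP
  rw [if_pos rfl] at h ⊢
  rwa [hitsP_pivSite hL hM hLM hc]

/-- A variable hit on the torus is hit, in Z^d, at one of its translates by a period. [folklore] -/
theorem exists_of_multP_ne_zero {c : (Fin d → ℤ) × Fin d} {z : Fin d → ℤ} {ν : Fin d} (h : multP L M c z ν ≠ 0) :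
    ν = c.2 ∧ ∃ z' : Fin d → ℤ, wrap M z' = z ∧ mult L c z' c.2 ≠ 0 := by
  unfold multP at h
  by_cases hν : ν = c.2
  · rw [if_pos hν] at h
    obtain ⟨xs, hxs⟩ := Finset.card_ne_zero.1 h
    rw [mem_hitsP] at hxs
    refine ⟨hν, xs.1 + (xs.2 : ℤ) • unitVec c.2, hxs.2, ?_⟩
    unfold mult
    rw [if_pos rfl]
    exact Finset.card_ne_zero.2 ⟨xs, mem_hits.2 ⟨hxs.1, rfl⟩⟩
  · rw [if_neg hν] at h
    exact absurd rfl h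

/-- KERNEL-CHECKED: the pivots are PRIVATE on the torus — the pivot of a face c′ occurs in (Q₁B)(c) only for
c = c′ (so the constraints are solved one at a time, and C copies no pivot). [folklore] -/
theorem cOf_eq_of_multP_ne_zero (hL : 0 < L) (hLM : ∀ i, L ∣ M i) {c : (Fin d → ℤ) × Fin d} {z : Fin d → ℤ}
    {ν : Fin d} (hc : c ∈ faces L M) (hz : cOf L z ν ∈ faces L M) (h : multP L M c z ν ≠ 0) : cOf L z ν = c := by
  obtain ⟨hν, z', hz', hm⟩ := exists_of_multP_ne_zero h
  have hv : IsPeriod M (z' - z) := by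
    have h0 := isPeriod_sub_wrap (M := M) z'
    rwa [hz'] at h0
  have hdvd : ∀ i, (L : ℤ) ∣ (cOf L z' c.2).1 i := by
    intro i
    have e : (cOf L z' c.2).1 i = (cOf L z ν).1 i + (z' - z) i := by
      rw [cOf_fst_apply, cOf_fst_apply, Pi.sub_apply, hν]
      ring
    rw [e]
    exact dvd_add (faces_dvd hz i) ((Int.natCast_dvd_natCast.2 (hLM i)).trans (hv i))
  have e := cOf_eq_of_mult_ne_zero hL (faces_dvd hc) hdvd hm
  have e1 : (cOf L z ν).1 = c.1 := by
    refine eq_of_mem_pbox_of_isPeriod (mem_coarseSites.1 (mem_faces.1 hz)).1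
      (mem_coarseSites.1 (mem_faces.1 hc)).1 fun i => ?_
    rw [← e, Pi.sub_apply, cOf_fst_apply, cOf_fst_apply, hν]
    have h1 := hv i
    rw [Pi.sub_apply] at h1
    have h2 : z i - (if i = c.2 then (L : ℤ) - 1 else 0) - (z' i - (if i = c.2 then (L : ℤ) - 1 else 0)) =
        -(z' i - z i) := by ring
    rw [h2]
    exact (dvd_neg).2 h1
  exact Prod.ext e1 (by rw [cOf_snd, hν])

/-- KERNEL-CHECKED RANGE on the torus: a variable occurring in (Q₁B)(c) starts within periodic distance L − 1 of the
pivot of c. [folklore] -/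
theorem pdist_le_of_multP_ne_zero (hL : 0 < L) (hM : ∀ i, 1 ≤ M i) {c : (Fin d → ℤ) × Fin d} {z : Fin d → ℤ}
    {ν : Fin d} (h : multP L M c z ν ≠ 0) : pdist M hM (pivSite L c) z ≤ (L : ℝ) - 1 := by
  obtain ⟨-, z', hz', hm⟩ := exists_of_multP_ne_zero h
  rw [← hz', pdist_wrap_right]
  exact (pdist_le_dist M hM _ _).trans (dist_le_of_mult_ne_zero hL hm)

/-- The periodic multiplicity is at most the number of s for which the (unique) box representative of z − se_ν lies
in B(c₋). [folklore] -/
theorem multP_le_card (hLM : ∀ i, L ∣ M i) {c : (Fin d → ℤ) × Fin d} (hc : c ∈ faces L M) (z : Fin d → ℤ)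
    (ν : Fin d) :
    multP L M c z ν ≤ ((Finset.range L).filter fun s : ℕ =>
      wrap M (z - (s : ℤ) • unitVec ν) ∈ B6Elimination.block L c.1 ∧ ν = c.2).card := by
  unfold multP
  by_cases hν : ν = c.2
  · rw [if_pos hν]
    have key : ∀ xs ∈ hitsP L M c z, wrap M (z - (xs.2 : ℤ) • unitVec ν) = xs.1 := by
      intro xs hxs
      obtain ⟨⟨hx, -⟩, hw⟩ := mem_hitsP.1 hxs
      rw [← hw, hν, sub_eq_add_neg, wrap_wrap_add, ← sub_eq_add_neg, add_sub_cancel_right]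
      exact wrap_eq_self (block_subset_pbox hLM (mem_faces.1 hc) hx)
    apply Finset.card_le_card_of_injOn Prod.snd
    · intro xs hxs
      have hxs' := Finset.mem_coe.mp hxs
      rw [Finset.mem_coe, Finset.mem_filter, Finset.mem_range]
      refine ⟨(mem_hitsP.1 hxs').1.2, ?_, hν⟩
      rw [key xs hxs']
      exact (mem_hitsP.1 hxs').1.1
    · intro xs hxs xs' hxs' h
      refine Prod.ext ?_ h
      rw [← key xs (Finset.mem_coe.mp hxs), ← key xs' (Finset.mem_coe.mp hxs'), show xs.2 = xs'.2 from h]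
  · rw [if_neg hν]
    exact Nat.zero_le _

/-- KERNEL-CHECKED COLUMN COUNT on the torus: a variable occurs, over ALL faces of the torus together, with total
multiplicity ≤ L (the blocks of distinct faces of one direction are disjoint). [folklore] -/
theorem sum_multP_le_L (hL : 0 < L) (hLM : ∀ i, L ∣ M i) (z : Fin d → ℤ) (ν : Fin d) :
    ∑ c ∈ faces L M, multP L M c z ν ≤ L := by
  calc ∑ c ∈ faces L M, multP L M c z ν
      ≤ ∑ c ∈ faces L M, ∑ s ∈ Finset.range L,
          (if wrap M (z - (s : ℤ) • unitVec ν) ∈ B6Elimination.block L c.1 ∧ ν = c.2 then 1 else 0) := by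
        refine Finset.sum_le_sum fun c hc => ?_
        rw [← Finset.card_filter]
        exact multP_le_card hLM hc z ν
    _ = ∑ s ∈ Finset.range L, ∑ c ∈ faces L M,
          (if wrap M (z - (s : ℤ) • unitVec ν) ∈ B6Elimination.block L c.1 ∧ ν = c.2 then 1 else 0) := Finset.sum_comm
    _ ≤ ∑ s ∈ Finset.range L, 1 := by
        refine Finset.sum_le_sum fun s _ => ?_
        rw [← Finset.card_filter]
        refine Finset.card_le_one.2 fun c hc c' hc' => ?_
        rw [Finset.mem_filter] at hc hc'
        obtain ⟨hcK, hb, hν⟩ := hc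
        obtain ⟨hcK', hb', hν'⟩ := hc'
        have e1 : corner L c.1 = c.1 := corner_eq_self_of_dvd c.1 (faces_dvd hcK)
        have e1' : corner L c'.1 = c'.1 := corner_eq_self_of_dvd c'.1 (faces_dvd hcK')
        rw [← e1, mem_block_corner_iff hL] at hb
        rw [← e1', mem_block_corner_iff hL] at hb'
        have e2 : c.1 = c'.1 := by
          rw [← e1, ← e1']
          exact hb.symm.trans hb'
        exact Prod.ext e2 (hν.symm.trans hν')
    _ = L := by simp

/-- The periodic multiplicity as an indicator sum over the pairs of (1.11). [folklore] -/
theorem multP_eq_sum_ite (c : (Fin d → ℤ) × Fin d) (z : Fin d → ℤ) (ν : Fin d) :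
    multP L M c z ν = ∑ xs ∈ B6Elimination.block L c.1 ×ˢ Finset.range L,
      (if wrap M (xs.1 + (xs.2 : ℤ) • unitVec c.2) = z ∧ ν = c.2 then 1 else 0) := by
  unfold multP hitsP
  by_cases hν : ν = c.2
  · simp only [hν, and_true, if_true]
    exact Finset.card_filter _ _
  · simp [hν]

/-- KERNEL-CHECKED ROW COUNT on the torus: the total multiplicity of (Q₁B)(c) over the variables of the box is
≤ |B(c₋)| · L = L^d · L. [folklore] -/
theorem sum_multP_le (c : (Fin d → ℤ) × Fin d) :
    ∑ b : B4.Idx (pbox M) d, multP L M c (b.1 : Fin d → ℤ) b.2 ≤ L ^ d * L := by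
  calc ∑ b : B4.Idx (pbox M) d, multP L M c (b.1 : Fin d → ℤ) b.2
      = ∑ b : B4.Idx (pbox M) d, ∑ xs ∈ B6Elimination.block L c.1 ×ˢ Finset.range L,
          (if wrap M (xs.1 + (xs.2 : ℤ) • unitVec c.2) = (b.1 : Fin d → ℤ) ∧ b.2 = c.2 then 1 else 0) :=
        Finset.sum_congr rfl fun b _ => multP_eq_sum_ite c _ _
    _ = ∑ xs ∈ B6Elimination.block L c.1 ×ˢ Finset.range L, ∑ b : B4.Idx (pbox M) d,
          (if wrap M (xs.1 + (xs.2 : ℤ) • unitVec c.2) = (b.1 : Fin d → ℤ) ∧ b.2 = c.2 then 1 else 0) :=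
        Finset.sum_comm
    _ ≤ ∑ xs ∈ B6Elimination.block L c.1 ×ˢ Finset.range L, 1 :=
        Finset.sum_le_sum fun xs _ => sum_idx_ite_le_one _ _
    _ = L ^ d * L := by
        rw [Finset.sum_const, smul_eq_mul, mul_one, Finset.card_product, card_block, Finset.card_range]

/-! ## §3  The periodic extension of a field on the box; (Q₁B)(c) of the torus as a weighted sum of the variables -/

section PerExt

variable (M) [∀ μ, NeZero (M μ)]

/-- L ≤ M_i ⇐ 1 ≤ M_i (all M_i ≠ 0). [folklore] -/
theorem one_le_M : ∀ i, 1 ≤ M i := fun i => Nat.one_le_iff_ne_zero.2 (NeZero.ne (M i))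

/-- The PERIODIC EXTENSION to all unit bonds of Z^d of a field on the variables of the box (the bonds of the torus,
once each): B^per(⟨z, z + e_ν⟩) = B(⟨wrap z, wrap z + e_ν⟩) — a configuration on the torus in the sense of
`B6Lemma24Torus.IsPeriodic`. [folklore] -/
def perExt (B : B4.Idx (pbox M) d → ℝ) : Cfg d :=
  fun b => B (⟨wrap M b.1, wrap_mem_pbox (pos_of_neZero M) b.1⟩, b.2)

/-- The same field read on `Tor M × Fin d` (the configuration type of `B5Bounds167Lattice`), through the
representatives `rep`. [folklore] -/
def ofBox (B : B4.Idx (pbox M) d → ℝ) : Tor M × Fin d → ℝ :=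
  fun p => B (⟨rep M p.1, rep_mem_pbox M p.1⟩, p.2)

/-- The two dictionaries agree: the periodic pull-back (`B6LowerBound2153Torus.lift`) of `ofBox B` is the periodic
extension of B. [folklore] -/
theorem lift_ofBox (B : B4.Idx (pbox M) d → ℝ) : lift M (ofBox M B) = perExt M B := by
  funext b
  rw [lift_apply]
  unfold ofBox perExt
  have h : (⟨rep M (toT M b.1), rep_mem_pbox M (toT M b.1)⟩ : ↥(pbox M)) =
      ⟨wrap M b.1, wrap_mem_pbox (pos_of_neZero M) b.1⟩ := Subtype.ext (rep_toT_eq_wrap M b.1)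
  rw [h]

/-- The periodic extension IS a configuration on the torus (M-periodic). [folklore] -/
theorem isPeriodic_perExt (B : B4.Idx (pbox M) d → ℝ) : IsPeriodic M (perExt M B) := by
  rw [← lift_ofBox]
  exact isPeriodic_lift M _

/-- On the bonds of the box the periodic extension is the field itself. [folklore] -/
theorem perExt_coe (B : B4.Idx (pbox M) d → ℝ) (p : B4.Idx (pbox M) d) :
    perExt M B ((p.1 : Fin d → ℤ), p.2) = B p := by
  unfold perExt
  have h : (⟨wrap M (p.1 : Fin d → ℤ), wrap_mem_pbox (pos_of_neZero M) _⟩ : ↥(pbox M)) = p.1 :=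
    Subtype.ext (wrap_eq_self p.1.2)
  rw [h]

/-- The box ≃ the torus sites: t ↦ its representative. [folklore] -/
def boxEquiv : Tor M ≃ ↥(pbox M) where
  toFun t := ⟨rep M t, rep_mem_pbox M t⟩
  invFun x := toT M (x : Fin d → ℤ)
  left_inv t := toT_rep M t
  right_inv x := Subtype.ext (rep_toT M x.2)

/-- A sum over the variables of the box is the corresponding sum over `Tor M × Fin d`. [folklore] -/
theorem sum_box_eq (g : B4.Idx (pbox M) d → ℝ) :
    ∑ p : B4.Idx (pbox M) d, g p = ∑ t : Tor M, ∑ ν : Fin d, g (⟨rep M t, rep_mem_pbox M t⟩, ν) := by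
  rw [Fintype.sum_prod_type]
  exact (Fintype.sum_equiv (boxEquiv M) _ _ fun t => rfl).symm

omit [∀ μ, NeZero (M μ)] in
/-- The value of a field at a variable, as a sum over the variables (the bond starting at w ∈ box in direction μ is
exactly one variable). [folklore] -/
theorem boxVal_eq_sum (B : B4.Idx (pbox M) d → ℝ) {w : Fin d → ℤ} (hw : w ∈ pbox M) (μ : Fin d) :
    B (⟨w, hw⟩, μ) = ∑ b : B4.Idx (pbox M) d, if w = (b.1 : Fin d → ℤ) ∧ b.2 = μ then B b else 0 := by
  rw [Finset.sum_eq_single_of_mem ((⟨w, hw⟩, μ) : B4.Idx (pbox M) d) (Finset.mem_univ _)]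
  · simp
  · intro b _ hb
    rw [if_neg]
    rintro ⟨h1, h2⟩
    exact hb (Prod.ext (Subtype.ext h1.symm) h2).symm.symm

omit [∀ μ, NeZero (M μ)] in
/-- The double sum of (2.125) on the torus collected by variable. [folklore] -/
theorem sum_block_range_iteP (c : (Fin d → ℤ) × Fin d) (b : B4.Idx (pbox M) d) (g : ℝ) :
    ∑ x ∈ B6Elimination.block L c.1, ∑ s ∈ Finset.range L,
        (if wrap M (x + (s : ℤ) • unitVec c.2) = (b.1 : Fin d → ℤ) ∧ b.2 = c.2 then g else 0)
      = (multP L M c (b.1 : Fin d → ℤ) b.2 : ℝ) * g := by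
  rw [← Finset.sum_product']
  unfold multP hitsP
  by_cases hν : b.2 = c.2
  · simp only [hν, and_true, if_true]
    rw [← Finset.sum_filter, Finset.sum_const, nsmul_eq_mul]
  · simp [hν]

/-- **(Q₁B)(c) ON THE TORUS as a weighted sum of the variables**: (Q₁B^per)(c) = L^{−(d+1)} Σ_b multP_c(b) B(b), with
(Q₁·)(c) VERBATIM from (2.125) (`B6Lemma24PrintedShape.q1`) applied to the periodic extension.
[cite: Balaban1984PropagatorsII, (2.125) p.245] -/
theorem q1_perExt_eq_sum_multP (B : B4.Idx (pbox M) d → ℝ) (c : (Fin d → ℤ) × Fin d) :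
    q1 L (perExt M B) c =
      ((L : ℝ) ^ (d + 1))⁻¹ * ∑ b : B4.Idx (pbox M) d, (multP L M c (b.1 : Fin d → ℤ) b.2 : ℝ) * B b := by
  unfold q1 segSum
  rw [← Finset.mul_sum]
  congr 1
  calc ∑ x ∈ B6Elimination.block L c.1, ∑ s ∈ Finset.range L, perExt M B (x + (s : ℤ) • unitVec c.2, c.2)
      = ∑ x ∈ B6Elimination.block L c.1, ∑ s ∈ Finset.range L, ∑ b : B4.Idx (pbox M) d,
          (if wrap M (x + (s : ℤ) • unitVec c.2) = (b.1 : Fin d → ℤ) ∧ b.2 = c.2 then B b else 0) :=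
        Finset.sum_congr rfl fun x _ => Finset.sum_congr rfl fun s _ =>
          boxVal_eq_sum M B (wrap_mem_pbox (pos_of_neZero M) _) _
    _ = ∑ x ∈ B6Elimination.block L c.1, ∑ b : B4.Idx (pbox M) d, ∑ s ∈ Finset.range L,
          (if wrap M (x + (s : ℤ) • unitVec c.2) = (b.1 : Fin d → ℤ) ∧ b.2 = c.2 then B b else 0) :=
        Finset.sum_congr rfl fun x _ => Finset.sum_comm
    _ = ∑ b : B4.Idx (pbox M) d, ∑ x ∈ B6Elimination.block L c.1, ∑ s ∈ Finset.range L,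
          (if wrap M (x + (s : ℤ) • unitVec c.2) = (b.1 : Fin d → ℤ) ∧ b.2 = c.2 then B b else 0) :=
        Finset.sum_comm
    _ = ∑ b : B4.Idx (pbox M) d, (multP L M c (b.1 : Fin d → ℤ) b.2 : ℝ) * B b :=
        Finset.sum_congr rfl fun b _ => sum_block_range_iteP M c b (B b)

end PerExt

/-! ## §4  The elimination matrix C of pp. 249–250 ON THE TORUS

p. 249–250: *"We remove the variables B_b for b ⊂ Γ_{y,x} using the δ-functions δ_{Ax}(B). Next we remove the
variables B_{b₀}, where b₀ is a bond belonging to B(c) for some c ∈ Λ′, and contained in c, using the δ-functions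
δ((QB)(c)). If we denote the remaining variables by B′, then we can write B = CB′, where C is a linear"* [operator].
Here Λ = the whole torus: the constraint bonds are ALL faces c of the torus (`B6Lemma24Torus.faces L M`), the tree
data ALL coarse sites (`coarseSites L M`); the remaining variables and the tree predicate are those of
`B6BondElimination` over Ω = the box (blocks and trees do not wrap: `B6Lemma24Torus.block_subset_pbox`); the pivot
rows carry the PERIODIC multiplicities `multP` (§2) in place of `mult`.  The proofs of this section transcribe
`B6BondElimination` §§4–5 (unit b06-g3) with `mult ↦ multP`. -/

section Elimination

variable (L) (M)

/-- The REMAINING VARIABLES B′ of p. 249 on the torus: the bonds of the box other than the pivots b₀(c) of the faces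
of the torus and the tree bonds Γ_{y,x} of its blocks (`B6BondElimination.freeB` over the box).
[cite: Balaban1984PropagatorsII, p.249] -/
abbrev freeT : Finset (B4.Idx (pbox M) d) := freeB L (pbox M) (faces L M) (coarseSites L M)

/-- THE ELIMINATION MATRIX C OF p. 250 ON THE TORUS, B = CB′: a remaining variable is copied; a tree bond is set to 0
(δ_{Ax}); the pivot b₀(c) of a face c is solved from δ((QB)(c)) with the torus average:
B_{b₀(c)} = −L^{−1} Σ_{b′ remaining} multP_c(b′) B′_{b′}.
[cite: Balaban1984PropagatorsII, (2.154)–(2.156) pp.249–250] -/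
def elimT : Matrix (B4.Idx (pbox M) d) (freeT L M) ℝ :=
  Matrix.of fun p f =>
    if p = (f : B4.Idx (pbox M) d) then 1
    else if IsTree L (coarseSites L M) p ∨ cOf L (p.1 : Fin d → ℤ) p.2 ∉ faces L M then 0
    else -((multP L M (cOf L (p.1 : Fin d → ℤ) p.2) ((f : B4.Idx (pbox M) d).1 : Fin d → ℤ)
      (f : B4.Idx (pbox M) d).2 : ℝ) / L)

variable {L M}

/-- The entries of C, unfolded. [folklore] -/
theorem elimT_apply (p : B4.Idx (pbox M) d) (f : freeT L M) :
    elimT L M p f =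
      if p = (f : B4.Idx (pbox M) d) then 1
      else if IsTree L (coarseSites L M) p ∨ cOf L (p.1 : Fin d → ℤ) p.2 ∉ faces L M then 0
      else -((multP L M (cOf L (p.1 : Fin d → ℤ) p.2) ((f : B4.Idx (pbox M) d).1 : Fin d → ℤ)
        (f : B4.Idx (pbox M) d).2 : ℝ) / L) :=
  rfl

/-- Diagonal entries of C on the remaining variables are 1. [folklore] -/
theorem elimT_apply_self (f : freeT L M) : elimT L M (f : B4.Idx (pbox M) d) f = 1 := by
  rw [elimT_apply, if_pos rfl]

/-- Off-diagonal entries of C vanish in the rows of tree bonds and of remaining variables. [folklore] -/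
theorem elimT_apply_zero {p : B4.Idx (pbox M) d} {f : freeT L M} (h1 : p ≠ (f : B4.Idx (pbox M) d))
    (h2 : IsTree L (coarseSites L M) p ∨ cOf L (p.1 : Fin d → ℤ) p.2 ∉ faces L M) : elimT L M p f = 0 := by
  rw [elimT_apply, if_neg h1, if_pos h2]

/-- The pivot rows of C: −multP/L. [folklore] -/
theorem elimT_apply_piv {p : B4.Idx (pbox M) d} {f : freeT L M} (h1 : p ≠ (f : B4.Idx (pbox M) d))
    (ht : ¬ IsTree L (coarseSites L M) p) (hK : cOf L (p.1 : Fin d → ℤ) p.2 ∈ faces L M) :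
    elimT L M p f =
      -((multP L M (cOf L (p.1 : Fin d → ℤ) p.2) ((f : B4.Idx (pbox M) d).1 : Fin d → ℤ)
        (f : B4.Idx (pbox M) d).2 : ℝ) / L) := by
  rw [elimT_apply, if_neg h1, if_neg (fun h => h.elim ht (fun h' => h' hK))]

/-- The entries of CB′. [folklore] -/
theorem elimT_mulVec_apply (w : freeT L M → ℝ) (p : B4.Idx (pbox M) d) :
    (elimT L M *ᵥ w) p =
      if hp : p ∈ freeT L M then w ⟨p, hp⟩
      else if IsTree L (coarseSites L M) p then 0
      else -(∑ f : freeT L M, (multP L M (cOf L (p.1 : Fin d → ℤ) p.2) ((f : B4.Idx (pbox M) d).1 : Fin d → ℤ)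
              (f : B4.Idx (pbox M) d).2 : ℝ) * w f) / L := by
  simp only [Matrix.mulVec, dotProduct, elimT, Matrix.of_apply]
  by_cases hp : p ∈ freeT L M
  · rw [dif_pos hp, Finset.sum_eq_single ⟨p, hp⟩]
    · simp
    · intro f _ hf
      have hne : p ≠ (f : B4.Idx (pbox M) d) := fun h => hf (Subtype.ext h).symm
      rw [if_neg hne, if_pos (Or.inr (mem_freeB.1 hp).1), zero_mul]
    · intro h
      exact absurd (Finset.mem_univ _) h
  · rw [dif_neg hp]
    by_cases ht : IsTree L (coarseSites L M) p
    · rw [if_pos ht]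
      refine Finset.sum_eq_zero fun f _ => ?_
      have hne : p ≠ (f : B4.Idx (pbox M) d) := fun h => (mem_freeB.1 (h ▸ f.2)).2 ht
      rw [if_neg hne, if_pos (Or.inl ht), zero_mul]
    · rw [if_neg ht]
      have hK : cOf L (p.1 : Fin d → ℤ) p.2 ∈ faces L M := by
        by_contra h
        exact hp (mem_freeB.2 ⟨h, ht⟩)
      have h1 : ∀ f : freeT L M, (if p = (f : B4.Idx (pbox M) d) then (1 : ℝ)
          else if IsTree L (coarseSites L M) p ∨ cOf L (p.1 : Fin d → ℤ) p.2 ∉ faces L M then 0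
          else -((multP L M (cOf L (p.1 : Fin d → ℤ) p.2) ((f : B4.Idx (pbox M) d).1 : Fin d → ℤ)
            (f : B4.Idx (pbox M) d).2 : ℝ) / L)) * w f =
          -((multP L M (cOf L (p.1 : Fin d → ℤ) p.2) ((f : B4.Idx (pbox M) d).1 : Fin d → ℤ)
            (f : B4.Idx (pbox M) d).2 : ℝ) * w f) / L := by
        intro f
        have hne : p ≠ (f : B4.Idx (pbox M) d) := fun h => (mem_freeB.1 (h ▸ f.2)).1 hK
        have hno : ¬ (IsTree L (coarseSites L M) p ∨ cOf L (p.1 : Fin d → ℤ) p.2 ∉ faces L M) :=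
          fun h => h.elim ht (fun h' => h' hK)
        rw [if_neg hne, if_neg hno]
        ring
      rw [Finset.sum_congr rfl fun f _ => h1 f, ← Finset.sum_div, Finset.sum_neg_distrib]

/-- (CB′)(b′) = B′(b′) on the remaining variables (p. 249 *"we can write B = CB′"*).
[cite: Balaban1984PropagatorsII, p.249] -/
theorem elimT_mulVec_free (w : freeT L M → ℝ) (f : freeT L M) :
    (elimT L M *ᵥ w) f = w f := by
  rw [elimT_mulVec_apply, dif_pos f.2]

/-- KERNEL-CHECKED, p. 250 *"(CB′)(Γ_{y,x}) = 0, x ∈ B(y), y ∈ Λ′, for arbitrary B′"* on the torus: CB′ vanishes on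
every tree bond of every block of the torus. [cite: Balaban1984PropagatorsII, p.250] -/
theorem elimT_mulVec_tree (w : freeT L M → ℝ) {p : B4.Idx (pbox M) d} (hp : IsTree L (coarseSites L M) p) :
    (elimT L M *ᵥ w) p = 0 := by
  have hF : p ∉ freeT L M := fun h => (mem_freeB.1 h).2 hp
  rw [elimT_mulVec_apply, dif_neg hF, if_pos hp]

/-- The columns of C are annihilated by the functional b ↦ multP_c(b) of every face c of the torus. [folklore] -/
theorem sum_multP_elimT [∀ μ, NeZero (M μ)] (hL : 0 < L) (hLM : ∀ i, L ∣ M i) {c : (Fin d → ℤ) × Fin d}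
    (hc : c ∈ faces L M) (f : freeT L M) :
    ∑ p : B4.Idx (pbox M) d, (multP L M c (p.1 : Fin d → ℤ) p.2 : ℝ) * elimT L M p f = 0 := by
  have hcL := faces_dvd hc
  have hcΩ : pivSite L c ∈ pbox M := pivSite_mem_pbox hL hLM hc
  have hfK : cOf L ((f : B4.Idx (pbox M) d).1 : Fin d → ℤ) (f : B4.Idx (pbox M) d).2 ∉ faces L M :=
    (mem_freeB.1 f.2).1
  have hb₀K : cOf L (pivSite L c) c.2 ∈ faces L M := by
    rw [cOf_pivSite]
    exact hc
  have hne : (f : B4.Idx (pbox M) d) ≠ ((⟨pivSite L c, hcΩ⟩, c.2) : B4.Idx (pbox M) d) := by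
    intro h
    rw [h] at hfK
    exact hfK hb₀K
  have hb₀t : ¬ IsTree L (coarseSites L M) ((⟨pivSite L c, hcΩ⟩, c.2) : B4.Idx (pbox M) d) :=
    not_isTree_of_piv hL hcL _ rfl rfl
  have hLr : (L : ℝ) ≠ 0 := by exact_mod_cast hL.ne'
  have e2 : elimT L M ((⟨pivSite L c, hcΩ⟩, c.2) : B4.Idx (pbox M) d) f =
      -((multP L M c ((f : B4.Idx (pbox M) d).1 : Fin d → ℤ) (f : B4.Idx (pbox M) d).2 : ℝ) / L) := by
    rw [elimT_apply_piv hne.symm hb₀t hb₀K]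
    dsimp only
    rw [cOf_pivSite]
  have e3 : (multP L M c (((⟨pivSite L c, hcΩ⟩, c.2) : B4.Idx (pbox M) d).1 : Fin d → ℤ)
      ((⟨pivSite L c, hcΩ⟩, c.2) : B4.Idx (pbox M) d).2 : ℝ) = L := by
    dsimp only
    rw [multP_pivSite hL (pos_of_neZero M) hLM hc]
  rw [Fintype.sum_eq_add (f : B4.Idx (pbox M) d) ((⟨pivSite L c, hcΩ⟩, c.2) : B4.Idx (pbox M) d) hne,
    elimT_apply_self, e2, e3]
  · field_simp
    ring
  · intro p hp
    obtain ⟨hpf, hpb⟩ := hp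
    by_cases h2 : IsTree L (coarseSites L M) p ∨ cOf L (p.1 : Fin d → ℤ) p.2 ∉ faces L M
    · rw [elimT_apply_zero hpf h2, mul_zero]
    · have hpK : cOf L (p.1 : Fin d → ℤ) p.2 ∈ faces L M := by
        by_contra h
        exact h2 (Or.inr h)
      have hm : multP L M c (p.1 : Fin d → ℤ) p.2 = 0 := by
        by_contra hm
        have e := cOf_eq_of_multP_ne_zero hL hLM hc hpK hm
        obtain ⟨e1, e4⟩ := eq_of_cOf_eq e
        exact hpb (Prod.ext (Subtype.ext e1) e4)
      rw [hm, Nat.cast_zero, zero_mul]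

/-- KERNEL-CHECKED, p. 250 *"By the definition of C we have of course that … QCB′ = 0 … for arbitrary B′"* ON THE
TORUS: (Q₁(CB′)^per)(c) = 0 for every face c of the torus, Q₁ verbatim from (2.125).
[cite: Balaban1984PropagatorsII, p.250] -/
theorem q1_elimT_mulVec [∀ μ, NeZero (M μ)] (hL : 0 < L) (hLM : ∀ i, L ∣ M i) (w : freeT L M → ℝ)
    {c : (Fin d → ℤ) × Fin d} (hc : c ∈ faces L M) : q1 L (perExt M (elimT L M *ᵥ w)) c = 0 := by
  rw [q1_perExt_eq_sum_multP]
  have h0 : ∑ b : B4.Idx (pbox M) d, (multP L M c (b.1 : Fin d → ℤ) b.2 : ℝ) * (elimT L M *ᵥ w) b = 0 := by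
    simp only [Matrix.mulVec, dotProduct, Finset.mul_sum]
    rw [Finset.sum_comm]
    refine Finset.sum_eq_zero fun f _ => ?_
    have h1 := sum_multP_elimT hL hLM hc f
    calc ∑ b : B4.Idx (pbox M) d, (multP L M c (b.1 : Fin d → ℤ) b.2 : ℝ) * (elimT L M b f * w f)
        = (∑ b : B4.Idx (pbox M) d, (multP L M c (b.1 : Fin d → ℤ) b.2 : ℝ) * elimT L M b f) * w f := by
          rw [Finset.sum_mul]
          exact Finset.sum_congr rfl fun b _ => by ring
      _ = 0 := by rw [h1, zero_mul]
  rw [h0, mul_zero]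

/-- The restriction B ↦ B′ = B↾(remaining variables). [folklore] -/
def restrT (B : B4.Idx (pbox M) d → ℝ) : freeT L M → ℝ := fun f => B f

/-- KERNEL-CHECKED (C PARAMETRIZES THE CONSTRAINED SUBSPACE of the torus): for B with (Q₁B^per)(c) = 0 at every face
of the torus and B = 0 on the tree bonds, C(B↾remaining) = B — C is onto {QB = 0, B(Γ_{y,x}) = 0} with the coordinate
projection as inverse (the change of variables (2.154) = (2.155)).
[cite: Balaban1984PropagatorsII, (2.154)–(2.155) pp.249–250] -/
theorem elimT_restrT [∀ μ, NeZero (M μ)] (hL : 0 < L) (hLM : ∀ i, L ∣ M i) {B : B4.Idx (pbox M) d → ℝ}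
    (h1 : ∀ c ∈ faces L M, q1 L (perExt M B) c = 0) (h2 : ∀ p, IsTree L (coarseSites L M) p → B p = 0) :
    elimT L M *ᵥ restrT B = B := by
  funext p
  rw [elimT_mulVec_apply]
  by_cases hp : p ∈ freeT L M
  · rw [dif_pos hp]
    rfl
  rw [dif_neg hp]
  by_cases ht : IsTree L (coarseSites L M) p
  · rw [if_pos ht, h2 p ht]
  rw [if_neg ht]
  have hcK : cOf L (p.1 : Fin d → ℤ) p.2 ∈ faces L M := by
    by_contra h
    exact hp (mem_freeB.2 ⟨h, ht⟩)
  have h0 : ∑ b : B4.Idx (pbox M) d,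
      (multP L M (cOf L (p.1 : Fin d → ℤ) p.2) (b.1 : Fin d → ℤ) b.2 : ℝ) * B b = 0 := by
    have h := h1 _ hcK
    rw [q1_perExt_eq_sum_multP] at h
    have hLne : ((L : ℝ) ^ (d + 1))⁻¹ ≠ 0 := by positivity
    exact (mul_eq_zero.mp h).resolve_left hLne
  rw [← Finset.sum_add_sum_compl (freeT L M), ← Finset.sum_coe_sort (freeT L M),
    Finset.sum_eq_single_of_mem p (Finset.mem_compl.2 hp)] at h0
  · have hm : multP L M (cOf L (p.1 : Fin d → ℤ) p.2) (p.1 : Fin d → ℤ) p.2 = L := by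
      have h := multP_pivSite hL (pos_of_neZero M) hLM hcK
      rwa [pivSite_cOf, cOf_snd] at h
    rw [hm] at h0
    have hLr : (L : ℝ) ≠ 0 := by exact_mod_cast hL.ne'
    simp only [restrT]
    field_simp
    linarith
  · intro b hb hbp
    by_cases ht' : IsTree L (coarseSites L M) b
    · rw [h2 b ht', mul_zero]
    · have hbK : cOf L (b.1 : Fin d → ℤ) b.2 ∈ faces L M := by
        by_contra h
        exact (Finset.mem_compl.1 hb) (mem_freeB.2 ⟨h, ht'⟩)
      have hm : multP L M (cOf L (p.1 : Fin d → ℤ) p.2) (b.1 : Fin d → ℤ) b.2 = 0 := by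
        by_contra hm
        have e := cOf_eq_of_multP_ne_zero hL hLM hcK hbK hm
        obtain ⟨e1, e2⟩ := eq_of_cOf_eq e
        rw [pivSite_cOf] at e1
        exact hbp (Prod.ext (Subtype.ext e1) (e2.trans (cOf_snd _ _)))
      rw [hm, Nat.cast_zero, zero_mul]

/-- KERNEL-CHECKED, the second inequality of (2.157) on the torus: ‖CB′‖² ≥ ‖B′‖² (B′ are some of the coordinates of
CB′). [cite: Balaban1984PropagatorsII, (2.157) p.250] -/
theorem elimT_iso (w : freeT L M → ℝ) : ∑ f, w f ^ 2 ≤ ∑ p, (elimT L M *ᵥ w) p ^ 2 := by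
  calc ∑ f, w f ^ 2 = ∑ f : freeT L M, (elimT L M *ᵥ w) (f : B4.Idx (pbox M) d) ^ 2 :=
        Finset.sum_congr rfl fun f _ => by rw [elimT_mulVec_free]
    _ = ∑ p ∈ freeT L M, (elimT L M *ᵥ w) p ^ 2 :=
        Finset.sum_coe_sort (freeT L M) (fun p => (elimT L M *ᵥ w) p ^ 2)
    _ ≤ ∑ p, (elimT L M *ᵥ w) p ^ 2 :=
        Finset.sum_le_univ_sum_of_nonneg fun p => sq_nonneg _

/-- KERNEL-CHECKED RANGE of C on the torus (p. 250 *"C is a short-ranged operator"*): C(b, b′) ≠ 0 ⇒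
ρ_M(b₋, b′₋) ≤ L − 1 in the PERIODIC distance. [cite: Balaban1984PropagatorsII, p.250] -/
theorem elimT_range [∀ μ, NeZero (M μ)] (hL : 0 < L) (p : B4.Idx (pbox M) d) (f : freeT L M) (h : elimT L M p f ≠ 0) :
    pdist M (one_le_M M) (p.1 : Fin d → ℤ) ((f : B4.Idx (pbox M) d).1 : Fin d → ℤ) ≤ (L : ℝ) - 1 := by
  simp only [elimT, Matrix.of_apply] at h
  by_cases h1 : p = (f : B4.Idx (pbox M) d)
  · rw [h1]
    have h0 : pdist M (one_le_M M) ((f : B4.Idx (pbox M) d).1 : Fin d → ℤ)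
        ((f : B4.Idx (pbox M) d).1 : Fin d → ℤ) = 0 := B4Sect5Torus.tdist_self M _
    rw [h0]
    have hL1 : (1 : ℝ) ≤ L := by exact_mod_cast hL
    linarith
  rw [if_neg h1] at h
  by_cases h2 : IsTree L (coarseSites L M) p ∨ cOf L (p.1 : Fin d → ℤ) p.2 ∉ faces L M
  · rw [if_pos h2] at h
    exact absurd rfl h
  rw [if_neg h2] at h
  have hm : multP L M (cOf L (p.1 : Fin d → ℤ) p.2) ((f : B4.Idx (pbox M) d).1 : Fin d → ℤ)
      (f : B4.Idx (pbox M) d).2 ≠ 0 := by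
    intro h0
    apply h
    rw [h0, Nat.cast_zero, zero_div, neg_zero]
  have h3 := pdist_le_of_multP_ne_zero hL (one_le_M M) hm
  rwa [pivSite_cOf] at h3

/-- At most one variable of the box is the pivot of a given bond c of the L-lattice. [folklore] -/
theorem sum_ite_cOf_le (c : (Fin d → ℤ) × Fin d) {a : ℝ} (ha : 0 ≤ a) :
    ∑ p : B4.Idx (pbox M) d, (if cOf L (p.1 : Fin d → ℤ) p.2 = c then a else 0) ≤ a := by
  rw [← Finset.sum_filter, Finset.sum_const, nsmul_eq_mul]
  have hcard : (Finset.univ.filter fun p : B4.Idx (pbox M) d => cOf L (p.1 : Fin d → ℤ) p.2 = c).card ≤ 1 := by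
    refine Finset.card_le_one.2 fun p hp p' hp' => ?_
    simp only [Finset.mem_filter, Finset.mem_univ, true_and] at hp hp'
    obtain ⟨e1, e2⟩ := eq_of_cOf_eq hp
    obtain ⟨e1', e2'⟩ := eq_of_cOf_eq hp'
    exact Prod.ext (Subtype.ext (e1.trans e1'.symm)) (e2.trans e2'.symm)
  exact mul_le_of_le_one_left ha (by exact_mod_cast hcard)

/-- KERNEL-CHECKED COLUMN SUMS of C on the torus: Σ_b |C(b, b′)| ≤ 2 (1 for b = b′, and at most L·(1/L) from the
pivots of the faces in whose torus average b′ occurs, by `sum_multP_le_L`). [cite: Balaban1984PropagatorsII, p.250] -/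
theorem elimT_col (hL : 0 < L) (hLM : ∀ i, L ∣ M i) (f : freeT L M) : ∑ p, |elimT L M p f| ≤ 2 := by
  have hLr : (0 : ℝ) < L := by exact_mod_cast hL
  have hpt : ∀ p : B4.Idx (pbox M) d, |elimT L M p f| ≤
      (if p = (f : B4.Idx (pbox M) d) then 1 else 0) +
        ∑ c ∈ faces L M, (if cOf L (p.1 : Fin d → ℤ) p.2 = c then
          (multP L M c ((f : B4.Idx (pbox M) d).1 : Fin d → ℤ) (f : B4.Idx (pbox M) d).2 : ℝ) / L else 0) := by
    intro p
    have hS : 0 ≤ ∑ c ∈ faces L M, (if cOf L (p.1 : Fin d → ℤ) p.2 = c then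
        (multP L M c ((f : B4.Idx (pbox M) d).1 : Fin d → ℤ) (f : B4.Idx (pbox M) d).2 : ℝ) / L else 0) :=
      Finset.sum_nonneg fun c _ => by split_ifs <;> positivity
    simp only [elimT, Matrix.of_apply]
    by_cases h1 : p = (f : B4.Idx (pbox M) d)
    · rw [if_pos h1, if_pos h1, abs_one]
      linarith
    rw [if_neg h1, if_neg h1, zero_add]
    by_cases h2 : IsTree L (coarseSites L M) p ∨ cOf L (p.1 : Fin d → ℤ) p.2 ∉ faces L M
    · rw [if_pos h2, abs_zero]
      exact hS
    rw [if_neg h2]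
    have hK : cOf L (p.1 : Fin d → ℤ) p.2 ∈ faces L M := by
      by_contra h
      exact h2 (Or.inr h)
    rw [Finset.sum_ite_eq (faces L M) (cOf L (p.1 : Fin d → ℤ) p.2), if_pos hK, abs_neg, abs_div,
      Nat.abs_cast, abs_of_pos hLr]
  calc ∑ p, |elimT L M p f|
      ≤ ∑ p : B4.Idx (pbox M) d, ((if p = (f : B4.Idx (pbox M) d) then (1 : ℝ) else 0) +
          ∑ c ∈ faces L M, (if cOf L (p.1 : Fin d → ℤ) p.2 = c then
            (multP L M c ((f : B4.Idx (pbox M) d).1 : Fin d → ℤ) (f : B4.Idx (pbox M) d).2 : ℝ) / L else 0)) :=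
        Finset.sum_le_sum fun p _ => hpt p
    _ = 1 + ∑ c ∈ faces L M, ∑ p : B4.Idx (pbox M) d, (if cOf L (p.1 : Fin d → ℤ) p.2 = c then
            (multP L M c ((f : B4.Idx (pbox M) d).1 : Fin d → ℤ) (f : B4.Idx (pbox M) d).2 : ℝ) / L else 0) := by
        rw [Finset.sum_add_distrib, Finset.sum_ite_eq' Finset.univ (f : B4.Idx (pbox M) d),
          if_pos (Finset.mem_univ _), Finset.sum_comm]
    _ ≤ 1 + ∑ c ∈ faces L M,
          (multP L M c ((f : B4.Idx (pbox M) d).1 : Fin d → ℤ) (f : B4.Idx (pbox M) d).2 : ℝ) / L := by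
        gcongr with c hc
        exact sum_ite_cOf_le c (by positivity)
    _ = 1 + (∑ c ∈ faces L M,
          (multP L M c ((f : B4.Idx (pbox M) d).1 : Fin d → ℤ) (f : B4.Idx (pbox M) d).2 : ℝ)) / L := by
        rw [Finset.sum_div]
    _ ≤ 1 + 1 := by
        gcongr
        rw [div_le_one hLr]
        exact_mod_cast sum_multP_le_L hL hLM _ _
    _ = 2 := by norm_num

/-- KERNEL-CHECKED ROW SUMS of C on the torus: Σ_{b′} |C(b, b′)| ≤ L^d (a pivot row carries the periodic
multiplicities divided by L, total ≤ L^d·L/L by `sum_multP_le`; other rows have one or no entry).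
[cite: Balaban1984PropagatorsII, p.250] -/
theorem elimT_row (hL : 0 < L) (p : B4.Idx (pbox M) d) : ∑ f, |elimT L M p f| ≤ (L : ℝ) ^ d := by
  have hLr : (0 : ℝ) < L := by exact_mod_cast hL
  have hL1 : (1 : ℝ) ≤ (L : ℝ) ^ d := one_le_pow₀ (by exact_mod_cast hL)
  by_cases hp : p ∈ freeT L M
  · have h1 : ∀ f : freeT L M, |elimT L M p f| = if f = ⟨p, hp⟩ then 1 else 0 := by
      intro f
      simp only [elimT, Matrix.of_apply]
      by_cases hf : f = ⟨p, hp⟩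
      · rw [if_pos hf, hf, if_pos rfl, abs_one]
      · have hne : p ≠ (f : B4.Idx (pbox M) d) := fun h => hf (Subtype.ext h.symm)
        rw [if_neg hne, if_pos (Or.inr (mem_freeB.1 hp).1), if_neg hf, abs_zero]
    rw [Finset.sum_congr rfl fun f _ => h1 f, Finset.sum_ite_eq' Finset.univ (⟨p, hp⟩ : freeT L M),
      if_pos (Finset.mem_univ _)]
    exact hL1
  by_cases ht : IsTree L (coarseSites L M) p
  · have h1 : ∀ f : freeT L M, |elimT L M p f| = 0 := by
      intro f
      simp only [elimT, Matrix.of_apply]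
      have hne : p ≠ (f : B4.Idx (pbox M) d) := fun h => (mem_freeB.1 (h ▸ f.2)).2 ht
      rw [if_neg hne, if_pos (Or.inl ht), abs_zero]
    rw [Finset.sum_congr rfl fun f _ => h1 f, Finset.sum_const_zero]
    positivity
  have hK : cOf L (p.1 : Fin d → ℤ) p.2 ∈ faces L M := by
    by_contra h
    exact hp (mem_freeB.2 ⟨h, ht⟩)
  have h1 : ∀ f : freeT L M, |elimT L M p f| =
      (multP L M (cOf L (p.1 : Fin d → ℤ) p.2) ((f : B4.Idx (pbox M) d).1 : Fin d → ℤ)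
        (f : B4.Idx (pbox M) d).2 : ℝ) / L := by
    intro f
    simp only [elimT, Matrix.of_apply]
    have hne : p ≠ (f : B4.Idx (pbox M) d) := fun h => (mem_freeB.1 (h ▸ f.2)).1 hK
    have hno : ¬ (IsTree L (coarseSites L M) p ∨ cOf L (p.1 : Fin d → ℤ) p.2 ∉ faces L M) :=
      fun h => h.elim ht (fun h' => h' hK)
    rw [if_neg hne, if_neg hno, abs_neg, abs_div, Nat.abs_cast, abs_of_pos hLr]
  rw [Finset.sum_congr rfl fun f _ => h1 f, ← Finset.sum_div, div_le_iff₀ hLr]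
  calc ∑ f : freeT L M,
        (multP L M (cOf L (p.1 : Fin d → ℤ) p.2) ((f : B4.Idx (pbox M) d).1 : Fin d → ℤ)
          (f : B4.Idx (pbox M) d).2 : ℝ)
      = ∑ b ∈ freeT L M, (multP L M (cOf L (p.1 : Fin d → ℤ) p.2) (b.1 : Fin d → ℤ) b.2 : ℝ) :=
        Finset.sum_coe_sort (freeT L M)
          (fun b : B4.Idx (pbox M) d => (multP L M (cOf L (p.1 : Fin d → ℤ) p.2) (b.1 : Fin d → ℤ) b.2 : ℝ))
    _ ≤ ∑ b : B4.Idx (pbox M) d, (multP L M (cOf L (p.1 : Fin d → ℤ) p.2) (b.1 : Fin d → ℤ) b.2 : ℝ) :=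
        Finset.sum_le_univ_sum_of_nonneg fun b => Nat.cast_nonneg _
    _ ≤ (L : ℝ) ^ d * L := by
        exact_mod_cast sum_multP_le (M := M) (cOf L (p.1 : Fin d → ℤ) p.2)

end Elimination

/-! ## §5  (2.153) on the torus: the hypothesis shape, and its DISCHARGE for the concrete (1.66) form -/

section Lower

variable (L) (M) [∀ μ, NeZero (M μ)]

/-- THE HYPOTHESIS SHAPE of (2.153) ON THE TORUS for an operator Δ on the bond variables of the box: *"⟨B, Δ_kB⟩ ≥
(γ₀/12d²)L^{−d−1}‖B‖², or Δ_k ≥ (γ₀/12d²)L^{−d−1} (2.153) on the subspace of B satisfying: QB = 0, B(Γ_{y,x}) = 0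
for x ∈ B(y)"* — the constant as a parameter γ, the constraints (Q₁B^per)(c) = 0 at every face c of the torus (Q₁
verbatim from (2.125), on the periodic extension) and B = 0 on the tree bonds of every block of the torus.
[cite: Balaban1984PropagatorsII, (2.153) p.249] -/
def LowerOnConstrainedT (Δ : Matrix (B4.Idx (pbox M) d) (B4.Idx (pbox M) d) ℝ) (γ : ℝ) : Prop :=
  ∀ B : B4.Idx (pbox M) d → ℝ, (∀ c ∈ faces L M, q1 L (perExt M B) c = 0) →
    (∀ p, IsTree L (coarseSites L M) p → B p = 0) → γ * ∑ p, B p ^ 2 ≤ ∑ p, B p * (Δ *ᵥ B) p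

variable {L}

/-- Δ REPRESENTS THE (1.66) FORM on the torus `Tor M` at level n = L^k: ⟨B, ΔB⟩ (bond basis, real fields on the
box) is the third expression of (1.66), `B5Bounds167Lattice.formDk n M`, of the same field read on `Tor M × Fin d`.
(The matrix of Δ_k in the bond basis; its identification with the operator of (1.65) is NOT certified in this
package, see `B5Bounds167Lattice`.) [cite: Balaban1984PropagatorsI, (1.66) p.29] -/
def Represents (n : ℕ) (Δ : Matrix (B4.Idx (pbox M) d) (B4.Idx (pbox M) d) ℝ) : Prop :=
  ∀ B : B4.Idx (pbox M) d → ℝ, ∑ p, B p * (Δ *ᵥ B) p = formDk n M (ofRealCfg M (ofBox M B))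

/-- The constant of (2.153) for the (1.66) form: (γ₀/12d²)L^{−d−1} with γ₀ = (4/π²)^{d+2} of (1.67)
(`B5Bounds167Lattice.ineq167`). [cite: Balaban1984PropagatorsII, (2.153) p.249; Balaban1984PropagatorsI, (1.67) p.29] -/
def gamma2153 (d L : ℕ) : ℝ :=
  (4 / Real.pi ^ 2) ^ (d + 2) / (12 * (d : ℝ) ^ 2) * (L : ℝ) ^ (-((d : ℝ) + 1))

/-- (γ₀/12d²)L^{−d−1} > 0 (d ≥ 1, L ≥ 1). [folklore] -/
theorem gamma2153_pos (hd : 1 ≤ d) (hL : 1 ≤ L) : 0 < gamma2153 d L := by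
  unfold gamma2153
  have h1 : (0 : ℝ) < d := by exact_mod_cast hd
  have h2 : (0 : ℝ) < L := by exact_mod_cast hL
  positivity

/-- **KERNEL-CHECKED — (2.153) ON THE WHOLE TORUS T^{(k)}, DISCHARGED** for every Δ representing the (1.66) form:
*"Using (2.118) and (2.128) we get ⟨B, Δ_kB⟩ ≥ (γ₀/12d²)L^{−d−1}‖B‖² … on the subspace of B satisfying: QB = 0,
B(Γ_{y,x}) = 0 for x ∈ B(y)"*, by NAME from `B6LowerBound2153Torus.lowerBound2153_lattice` (Lemma 2.4 (2.128) on
the torus + (1.67) = (2.118)) through the dictionary of §3 (trees: `B6BondElimination.isTree_iff`).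
[cite: Balaban1984PropagatorsII, (2.153) p.249, (2.128) p.245, (2.118) p.243; Balaban1984PropagatorsI, (1.67) p.29] -/
theorem lowerOnConstrainedT_of_represents (hd : 2 ≤ d) (hL : 1 ≤ L) (n : ℕ) (hn : 1 ≤ n) (hLM : ∀ i, L ∣ M i)
    {Δ : Matrix (B4.Idx (pbox M) d) (B4.Idx (pbox M) d) ℝ} (hΔ : Represents M n Δ) :
    LowerOnConstrainedT L M Δ (gamma2153 d L) := by
  intro B hQ hT
  have hL0 : 0 < L := hL
  rw [hΔ B]
  have hT' : ∀ y ∈ coarseSites L M, ∀ b ∈ treeBonds L y, lift M (ofBox M B) b = 0 := by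
    intro y hy b hb
    rw [lift_ofBox]
    have hb1 : b.1 ∈ pbox M := block_subset_pbox hLM hy (mem_treeBonds.1 hb).1
    have e : perExt M B b = B (⟨b.1, hb1⟩, b.2) := by
      unfold perExt
      have h : (⟨wrap M b.1, wrap_mem_pbox (pos_of_neZero M) b.1⟩ : ↥(pbox M)) = ⟨b.1, hb1⟩ :=
        Subtype.ext (wrap_eq_self hb1)
      rw [h]
    rw [e]
    refine hT _ ((isTree_iff hL0 coarseSites_dvd _).2 ⟨y, hy, ?_⟩)
    exact hb
  have hQ' : ∀ c ∈ faces L M, q1 L (lift M (ofBox M B)) c = 0 := by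
    intro c hc
    rw [lift_ofBox]
    exact hQ c hc
  have key := lowerBound2153_lattice M hd hL n hn hLM (ofBox M B) hT' hQ'
  have hs : ∑ t : Tor M, ∑ ν, ofBox M B (t, ν) ^ 2 = ∑ p : B4.Idx (pbox M) d, B p ^ 2 := by
    rw [sum_box_eq M (fun p => B p ^ 2)]
    rfl
  unfold gamma2153
  rw [← hs]
  exact key

end Lower

/-! ## §6  The packaging, [3] on tori discharged, and (2.152)–(2.157) END-TO-END on the whole torus -/

section EndToEnd

variable (L) (M) [∀ μ, NeZero (M μ)]

/-- The instance of the sub-family reduction scheme ON THE TORUS: variables = the bonds of the box (the torus bonds,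
once each), kept variables = `freeT`, C = `elimT`, covariance `SubReduction.cov` = C(C*ΔC)⁻¹C* of (2.156).
[cite: Balaban1984PropagatorsII, (2.156) p.250] -/
def bondReductionT (Δ : Matrix (B4.Idx (pbox M) d) (B4.Idx (pbox M) d) ℝ) : SubReduction d d :=
  ⟨pbox M, freeT L M, Δ, elimT L M⟩

variable {L M}

omit [∀ μ, NeZero (M μ)] in
/-- The covariance of the instance is literally (2.156): C(C*ΔC)⁻¹C* with C = `elimT`.
[cite: Balaban1984PropagatorsII, (2.156) p.250] -/
theorem bondReductionT_cov (Δ : Matrix (B4.Idx (pbox M) d) (B4.Idx (pbox M) d) ℝ) :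
    (bondReductionT L M Δ).cov = elimT L M * ((elimT L M)ᵀ * Δ * elimT L M)⁻¹ * (elimT L M)ᵀ := rfl

/-- KERNEL-CHECKED: on the torus with L ∣ M_i, Δ symmetric with entry decay (c₀, δ₀) in the periodic distance ρ_M and
(2.153) with constant γ on {QB = 0 (torus average), B(Γ_{y,x}) = 0} give the printed-shape inputs in ρ_M with
range L − 1 and ℓ¹ sums ≤ L^d + 1 for the explicit C = `elimT` — the first inequality of (2.157) being (2.153)
applied to B = CB′, which lies in the constrained subspace by `q1_elimT_mulVec` and `elimT_mulVec_tree`.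
[cite: Balaban1984PropagatorsII, (2.153)–(2.157) pp.249–250] -/
theorem bondReductionT_printedPer (hL : 0 < L) (hLM : ∀ i, L ∣ M i)
    {Δ : Matrix (B4.Idx (pbox M) d) (B4.Idx (pbox M) d) ℝ} {γ c₀ δ₀ : ℝ} (hs : Δ.IsSymm)
    (hd : ∀ p q : B4.Idx (pbox M) d,
      |Δ p q| ≤ c₀ * Real.exp (-(δ₀ * pdist M (one_le_M M) (p.1 : Fin d → ℤ) (q.1 : Fin d → ℤ))))
    (hl : LowerOnConstrainedT L M Δ γ) :
    PrintedPer M (one_le_M M) (bondReductionT L M Δ) γ c₀ δ₀ ((L : ℝ) - 1) ((L : ℝ) ^ d + 1) where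
  symm := hs
  decay := hd
  lower w := hl _ (fun c hc => q1_elimT_mulVec hL hLM w hc) (fun p hp => elimT_mulVec_tree w hp)
  iso w := elimT_iso w
  range p k h := elimT_range hL p k h
  col k := (elimT_col hL hLM k).trans (by
    have h1 : (1 : ℝ) ≤ (L : ℝ) ^ d := one_le_pow₀ (by exact_mod_cast hL)
    linarith)
  row p := (elimT_row hL p).trans (by linarith)

variable (d) in
/-- KERNEL-CHECKED — the sentence of p. 250 ON THE WHOLE TORUS with the torus average, [3] DISCHARGED: *"C is a
short-ranged operator, so C*Δ_kC has the same exponential decay as Δ_k. Now we may apply the theory developed in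
Sect. 5 of [3] on unit lattice operators. It gives us an exponential decay … for the operator (C*Δ_kC)⁻¹, hence for
C^{(k)}_Λ also."*  ONE (c, δ) — chosen after (d, L, γ, c₀, δ₀), before the torus and the operator — such that for
EVERY torus (periods M_i, L ∣ M_i) and EVERY symmetric Δ on its bond variables with |Δ(b,b′)| ≤ c₀e^{−δ₀ρ_M(b₋,b′₋)}
and (2.153) with constant γ on the constrained subspace OF THE TORUS, |C(C*ΔC)⁻¹C*(b,b′)| ≤ c·e^{−δρ_M(b₋,b′₋)}
(`bondReductionT_printedPer` → `B6BondEliminationTorus.subReductions_per`, engine of the periodic class proved).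
[cite: Balaban1984PropagatorsII, (2.152)–(2.157) pp.249–250] -/
theorem bond250_torusT (hL : 0 < L) {γ c₀ δ₀ : ℝ} (hγ : 0 < γ) (hc : 0 < c₀) (hδ : 0 < δ₀) :
    ∃ c δ : ℝ, 0 < c ∧ 0 < δ ∧
      ∀ (M : Fin d → ℕ) [∀ μ, NeZero (M μ)], (∀ i, L ∣ M i) →
        ∀ Δ : Matrix (B4.Idx (pbox M) d) (B4.Idx (pbox M) d) ℝ, Δ.IsSymm →
        (∀ p q : B4.Idx (pbox M) d, |Δ p q| ≤
          c₀ * Real.exp (-(δ₀ * pdist M (one_le_M M) (p.1 : Fin d → ℤ) (q.1 : Fin d → ℤ)))) →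
        LowerOnConstrainedT L M Δ γ →
        ∀ p q : B4.Idx (pbox M) d, |(bondReductionT L M Δ).cov p q| ≤
          c * Real.exp (-(δ * pdist M (one_le_M M) (p.1 : Fin d → ℤ) (q.1 : Fin d → ℤ))) := by
  have hm : (0 : ℝ) < (L : ℝ) ^ d + 1 := by positivity
  obtain ⟨c, δ, hc', hδ', H⟩ := subReductions_per d d (r := (L : ℝ) - 1) hγ hc hδ hm
  exact ⟨c, δ, hc', hδ', fun M _ hLM Δ hs hd hl p q =>
    H M (one_le_M M) (bondReductionT L M Δ) (box_separated M (one_le_M M))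
      (bondReductionT_printedPer hL hLM hs hd hl) p q⟩

variable (d) in
/-- **KERNEL-CHECKED — B6 (2.152)–(2.157) END-TO-END ON THE WHOLE TORUS T^{(k)} FOR THE CONCRETE (1.66) FORM, modulo
the decay of Δ_k.**  Let d ≥ 2, L ≥ 1, c₀, δ₀ > 0.  There are c, δ > 0 (depending on d, L, c₀, δ₀ only) such that
for EVERY torus T^{(k)} = Z^d/(M₁Z × ⋯ × M_dZ) with L ∣ M_i, EVERY n ≥ 1 (n = L^k, the level entering (1.66) through
Δ^{(n)}), and EVERY symmetric operator Δ on the bond variables of the torus REPRESENTING THE (1.66) FORM at level n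
(`Represents`) whose kernel decays as |Δ(b,b′)| ≤ c₀e^{−δ₀ρ_M(b₋,b′₋)}: the covariance C^{(k)} = C(C*Δ_kC)⁻¹C* of
(2.156) of the Gaussian integral (2.152)/(2.154) on the whole lattice T^{(k)} — δ(QB) with the torus average, δ_{Ax}
on every block, the EXPLICIT C of p. 250 (`elimT`) — satisfies |C^{(k)}(b,b′)| ≤ c·e^{−δρ_M(b₋,b′₋)}.  Chain, all
proved: (2.153) on T (`lowerOnConstrainedT_of_represents` ← `B6LowerBound2153Torus.lowerBound2153_lattice` ←
Lemma 2.4 on T + (1.67)) → (2.157) (`bondReductionT_printedPer`) → Sect. 5 of [3] on tori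
(`B6BondEliminationTorus.subReductions_per`).  NOT PROVED HERE (hypothesis `hdec`): the exponential decay of the
kernel of Δ_k itself, which p. 250 presupposes (*"C*Δ_kC has the same exponential decay as Δ_k"*).
[cite: Balaban1984PropagatorsII, (2.152)–(2.157) pp.249–250; Balaban1984PropagatorsI, (1.66)–(1.67) p.29] -/
theorem cov2156_torus (hd : 2 ≤ d) (hL : 1 ≤ L) {c₀ δ₀ : ℝ} (hc : 0 < c₀) (hδ : 0 < δ₀) :
    ∃ c δ : ℝ, 0 < c ∧ 0 < δ ∧
      ∀ (M : Fin d → ℕ) [∀ μ, NeZero (M μ)], (∀ i, L ∣ M i) → ∀ n : ℕ, 1 ≤ n →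
        ∀ Δ : Matrix (B4.Idx (pbox M) d) (B4.Idx (pbox M) d) ℝ, Δ.IsSymm → Represents M n Δ →
        (∀ p q : B4.Idx (pbox M) d, |Δ p q| ≤
          c₀ * Real.exp (-(δ₀ * pdist M (one_le_M M) (p.1 : Fin d → ℤ) (q.1 : Fin d → ℤ)))) →
        ∀ p q : B4.Idx (pbox M) d, |(bondReductionT L M Δ).cov p q| ≤
          c * Real.exp (-(δ * pdist M (one_le_M M) (p.1 : Fin d → ℤ) (q.1 : Fin d → ℤ))) := by
  have hd1 : 1 ≤ d := by omega
  obtain ⟨c, δ, hc', hδ', H⟩ := bond250_torusT d (L := L) hL (gamma2153_pos hd1 hL) hc hδ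
  exact ⟨c, δ, hc', hδ', fun M _ hLM n hn Δ hs hR hdec p q =>
    H M hLM Δ hs hdec (lowerOnConstrainedT_of_represents M hd hL n hn hLM hR) p q⟩

end EndToEnd

/-! ## §7  The matrix of the (1.66) form (polarization): `Represents` is satisfiable, by ONE explicit symmetric Δ -/

section Polarization

variable (M) [∀ μ, NeZero (M μ)]

omit [∀ μ, NeZero (M μ)] in
/-- An abstract polarization identity: for complex coefficients φ_p(j) and real weights w_j,
Σ_{p,q} B_p B_q Σ_j w_j Re(conj φ_p(j) · φ_q(j)) = Σ_j w_j |Σ_p B_p φ_p(j)|². [folklore] -/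
theorem polarize {ι J : Type*} [Fintype ι] [Fintype J] (φ : ι → J → ℂ) (w : J → ℝ) (B : ι → ℝ) :
    ∑ p, ∑ q, B p * B q * ∑ j, w j * ((starRingEnd ℂ) (φ p j) * φ q j).re =
      ∑ j, w j * ‖∑ p, (B p : ℂ) * φ p j‖ ^ 2 := by
  have key : ∀ j, ‖∑ p, (B p : ℂ) * φ p j‖ ^ 2 =
      ∑ p, ∑ q, B p * B q * ((starRingEnd ℂ) (φ p j) * φ q j).re := by
    intro j
    rw [← Complex.normSq_eq_norm_sq]
    have h1 : (Complex.normSq (∑ p, (B p : ℂ) * φ p j) : ℝ) =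
        ((starRingEnd ℂ) (∑ p, (B p : ℂ) * φ p j) * ∑ p, (B p : ℂ) * φ p j).re := by
      rw [← Complex.normSq_eq_conj_mul_self, Complex.ofReal_re]
    rw [h1, map_sum, Finset.sum_mul_sum, Complex.re_sum]
    refine Finset.sum_congr rfl fun p _ => ?_
    rw [Complex.re_sum]
    refine Finset.sum_congr rfl fun q _ => ?_
    rw [map_mul, Complex.conj_ofReal]
    have : ((B p : ℂ) * (starRingEnd ℂ) (φ p j) * ((B q : ℂ) * φ q j)) =
        ((B p * B q : ℝ) : ℂ) * ((starRingEnd ℂ) (φ p j) * φ q j) := by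
      push_cast
      ring
    rw [this, Complex.re_ofReal_mul]
  symm
  calc ∑ j, w j * ‖∑ p, (B p : ℂ) * φ p j‖ ^ 2
      = ∑ j, ∑ p, ∑ q, w j * (B p * B q * ((starRingEnd ℂ) (φ p j) * φ q j).re) := by
        refine Finset.sum_congr rfl fun j _ => ?_
        rw [key j, Finset.mul_sum]
        refine Finset.sum_congr rfl fun p _ => ?_
        rw [Finset.mul_sum]
    _ = ∑ p, ∑ j, ∑ q, w j * (B p * B q * ((starRingEnd ℂ) (φ p j) * φ q j).re) := Finset.sum_comm
    _ = ∑ p, ∑ q, ∑ j, w j * (B p * B q * ((starRingEnd ℂ) (φ p j) * φ q j).re) := by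
        refine Finset.sum_congr rfl fun p _ => ?_
        exact Finset.sum_comm
    _ = ∑ p, ∑ q, B p * B q * ∑ j, w j * ((starRingEnd ℂ) (φ p j) * φ q j).re := by
        refine Finset.sum_congr rfl fun p _ => Finset.sum_congr rfl fun q _ => ?_
        rw [Finset.mul_sum]
        refine Finset.sum_congr rfl fun j _ => ?_
        ring

omit [∀ μ, NeZero (M μ)] in
/-- ⟨B, SB⟩ as a double sum. [folklore] -/
theorem quad_eq_sum_sum {ι : Type*} [Fintype ι] (S : Matrix ι ι ℝ) (B : ι → ℝ) :
    ∑ p, B p * (S *ᵥ B) p = ∑ p, ∑ q, B p * B q * S p q := by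
  refine Finset.sum_congr rfl fun p _ => ?_
  simp only [Matrix.mulVec, dotProduct, Finset.mul_sum]
  refine Finset.sum_congr rfl fun q _ => ?_
  ring

omit [∀ μ, NeZero (M μ)] in
/-- The basis vector e_a. [folklore] -/
def bvec {ι : Type*} [DecidableEq ι] (a : ι) : ι → ℝ := Pi.single a 1

omit [∀ μ, NeZero (M μ)] in
/-- ⟨e_a, Se_b⟩ = S(a, b). [folklore] -/
theorem bvec_quad {ι : Type*} [Fintype ι] [DecidableEq ι] (S : Matrix ι ι ℝ) (a b : ι) :
    ∑ p, bvec a p * (S *ᵥ bvec b) p = S a b := by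
  simp [bvec, Matrix.mulVec, dotProduct, Pi.single_apply, Finset.sum_ite_eq', ite_mul, mul_ite]

omit [∀ μ, NeZero (M μ)] in
/-- A symmetric real matrix is determined by its quadratic form. [folklore] -/
theorem eq_of_quad_eq {ι : Type*} [Fintype ι] [DecidableEq ι] {S S' : Matrix ι ι ℝ} (hS : S.IsSymm)
    (hS' : S'.IsSymm) (h : ∀ B : ι → ℝ, ∑ p, B p * (S *ᵥ B) p = ∑ p, B p * (S' *ᵥ B) p) : S = S' := by
  have sym : ∀ T : Matrix ι ι ℝ, T.IsSymm → ∀ u v : ι → ℝ,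
      ∑ p, v p * (T *ᵥ u) p = ∑ p, u p * (T *ᵥ v) p := by
    intro T hT u v
    change v ⬝ᵥ (T *ᵥ u) = u ⬝ᵥ (T *ᵥ v)
    rw [Matrix.dotProduct_mulVec, ← Matrix.mulVec_transpose, hT.eq, dotProduct_comm]
  have pol : ∀ T : Matrix ι ι ℝ, T.IsSymm → ∀ u v : ι → ℝ,
      2 * ∑ p, u p * (T *ᵥ v) p =
        ∑ p, (u + v) p * (T *ᵥ (u + v)) p - ∑ p, u p * (T *ᵥ u) p - ∑ p, v p * (T *ᵥ v) p := by
    intro T hT u v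
    rw [Matrix.mulVec_add]
    simp only [Pi.add_apply, add_mul, mul_add, Finset.sum_add_distrib]
    rw [sym T hT u v]
    ring
  ext a b
  have e1 := pol S hS (bvec a) (bvec b)
  have e2 := pol S' hS' (bvec a) (bvec b)
  rw [bvec_quad] at e1 e2
  rw [h, h, h] at e1
  linarith

/-- The complex coefficients of the (1.66) form: B ↦ ∂¹_μ(p′)B̃_ν(p′) − ∂¹_ν(p′)B̃_μ(p′)
(`B5Bounds167Lattice.curlHat`) of the field read on `Tor M` — ℝ-linear in B. [cite: Balaban1984PropagatorsI, (1.66) p.29] -/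
def phiC (B : B4.Idx (pbox M) d → ℝ) (μ ν : Fin d) (k : Tor M) : ℂ :=
  B5Bounds167Lattice.curlHat M (ofRealCfg M (ofBox M B)) μ ν k

/-- Additivity of the component fields under `ofBox`/`ofRealCfg`. [folklore] -/
theorem comp_ofBox_add (B B' : B4.Idx (pbox M) d → ℝ) (ν : Fin d) :
    B5Bounds167Lattice.comp M (ofRealCfg M (ofBox M (B + B'))) ν =
      B5Bounds167Lattice.comp M (ofRealCfg M (ofBox M B)) ν +
        B5Bounds167Lattice.comp M (ofRealCfg M (ofBox M B')) ν := by
  funext x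
  simp [B5Bounds167Lattice.comp, ofRealCfg, ofBox]

/-- Homogeneity of the component fields under `ofBox`/`ofRealCfg`. [folklore] -/
theorem comp_ofBox_smul (a : ℝ) (B : B4.Idx (pbox M) d → ℝ) (ν : Fin d) :
    B5Bounds167Lattice.comp M (ofRealCfg M (ofBox M (a • B))) ν =
      (a : ℂ) • B5Bounds167Lattice.comp M (ofRealCfg M (ofBox M B)) ν := by
  funext x
  simp [B5Bounds167Lattice.comp, ofRealCfg, ofBox]

/-- Additivity of φ. [folklore] -/
theorem phiC_add (B B' : B4.Idx (pbox M) d → ℝ) (μ ν : Fin d) (k : Tor M) :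
    phiC M (B + B') μ ν k = phiC M B μ ν k + phiC M B' μ ν k := by
  unfold phiC B5Bounds167Lattice.curlHat B5Bounds167Lattice.hat
  rw [comp_ofBox_add, comp_ofBox_add, Matrix.mulVec_add, Matrix.mulVec_add]
  simp only [Pi.add_apply]
  ring

/-- Homogeneity of φ. [folklore] -/
theorem phiC_smul (a : ℝ) (B : B4.Idx (pbox M) d → ℝ) (μ ν : Fin d) (k : Tor M) :
    phiC M (a • B) μ ν k = (a : ℂ) * phiC M B μ ν k := by
  unfold phiC B5Bounds167Lattice.curlHat B5Bounds167Lattice.hat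
  rw [comp_ofBox_smul, comp_ofBox_smul, Matrix.mulVec_smul, Matrix.mulVec_smul]
  simp only [Pi.smul_apply, smul_eq_mul]
  ring

/-- φ as a bundled ℝ-linear map. [folklore] -/
def phiLin (μ ν : Fin d) (k : Tor M) : (B4.Idx (pbox M) d → ℝ) →ₗ[ℝ] ℂ where
  toFun B := phiC M B μ ν k
  map_add' B B' := phiC_add M B B' μ ν k
  map_smul' a B := by
    rw [phiC_smul, RingHom.id_apply, Complex.real_smul]

/-- φ(B) = Σ_b B(b) φ(e_b). [folklore] -/
theorem phiC_eq_sum (B : B4.Idx (pbox M) d → ℝ) (μ ν : Fin d) (k : Tor M) :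
    phiC M B μ ν k = ∑ p, (B p : ℂ) * phiC M (Pi.single p 1) μ ν k := by
  have h : B = ∑ p, B p • (Pi.single p (1 : ℝ) : B4.Idx (pbox M) d → ℝ) := by
    funext q
    simp [Finset.sum_apply, Pi.single_apply]
  conv_lhs => rw [h]
  change phiLin M μ ν k (∑ p, B p • (Pi.single p (1 : ℝ) : B4.Idx (pbox M) d → ℝ)) = _
  rw [map_sum]
  refine Finset.sum_congr rfl fun p _ => ?_
  rw [map_smul, Complex.real_smul]
  rfl

variable (n : ℕ)

/-- The weights ½·w166(p′) of the third expression of (1.66), indexed by (μ, ν, p′). [cite: Balaban1984PropagatorsI, (1.66) p.29] -/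
def wgt (j : (Fin d × Fin d) × Tor M) : ℝ :=
  1 / 2 * B5Bounds167Lattice.w166 n j.1.1 j.1.2 (B5Prop11Plancherel.sOf M j.2)

/-- THE MATRIX OF THE (1.66) FORM in the bond basis of the torus (polarization):
Δ(b, b′) = Σ_{(μ,ν,p′)} ½w166(p′) Re( conj φ_{μνp′}(e_b) · φ_{μνp′}(e_{b′}) ). [cite: Balaban1984PropagatorsI, (1.66) p.29] -/
def deltaPol : Matrix (B4.Idx (pbox M) d) (B4.Idx (pbox M) d) ℝ := fun p q =>
  ∑ j : (Fin d × Fin d) × Tor M, wgt M n j *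
    ((starRingEnd ℂ) (phiC M (Pi.single p 1) j.1.1 j.1.2 j.2) * phiC M (Pi.single q 1) j.1.1 j.1.2 j.2).re

/-- KERNEL-CHECKED: the polarization matrix is symmetric. [folklore] -/
theorem deltaPol_isSymm : (deltaPol M n).IsSymm := by
  refine Matrix.IsSymm.ext fun p q => ?_
  unfold deltaPol
  refine Finset.sum_congr rfl fun j _ => ?_
  congr 1
  simp only [Complex.mul_re, Complex.conj_re, Complex.conj_im]
  ring

/-- KERNEL-CHECKED: the polarization matrix REPRESENTS the (1.66) form — ⟨B, ΔB⟩ = `formDk n M` of the field read on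
the torus, for every real B on the torus bonds; so the hypothesis `Represents` of `cov2156_torus` is satisfiable, by
the explicit `deltaPol`. [cite: Balaban1984PropagatorsI, (1.66) p.29] -/
theorem represents_deltaPol : Represents M n (deltaPol M n) := by
  intro B
  rw [quad_eq_sum_sum]
  unfold deltaPol
  rw [polarize]
  unfold B5Bounds167Lattice.formDk
  rw [Finset.mul_sum, Fintype.sum_prod_type, Fintype.sum_prod_type]
  refine Finset.sum_congr rfl fun μ _ => ?_
  rw [Finset.mul_sum]
  refine Finset.sum_congr rfl fun ν _ => ?_
  rw [Finset.mul_sum]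
  refine Finset.sum_congr rfl fun k _ => ?_
  unfold wgt
  rw [← phiC_eq_sum]
  unfold phiC
  ring

/-- KERNEL-CHECKED UNIQUENESS: a symmetric matrix representing the (1.66) form IS the polarization matrix, so
`cov2156_torus` speaks about ONE operator per (n, torus) — the matrix of the (1.66) form. [folklore] -/
theorem eq_deltaPol_of_represents {Δ : Matrix (B4.Idx (pbox M) d) (B4.Idx (pbox M) d) ℝ} (hs : Δ.IsSymm)
    (hR : Represents M n Δ) : Δ = deltaPol M n :=
  eq_of_quad_eq hs (deltaPol_isSymm M n) fun B => by rw [hR B, represents_deltaPol M n B]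

end Polarization

section Explicit

/-- THE RESIDUAL HYPOTHESIS OF THIS MODULE, NAMED: on the torus with periods M, at level n, the kernel of THE matrix of
the (1.66) form (`deltaPol M n`) decays with constants (c₀, δ₀) in the periodic distance ρ_M:
|Δ_k(b, b′)| ≤ c₀e^{−δ₀ρ_M(b₋, b′₋)}.  NOT PROVED in this package (p. 250 presupposes it: *"C*Δ_kC has the same
exponential decay as Δ_k"*); offered to the strip/analyticity lane. [cite: Balaban1984PropagatorsII, p.250] -/
def KernelDecay (M : Fin d → ℕ) [∀ μ, NeZero (M μ)] (n : ℕ) (c₀ δ₀ : ℝ) : Prop :=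
  ∀ p q : B4.Idx (pbox M) d, |deltaPol M n p q| ≤
    c₀ * Real.exp (-(δ₀ * pdist M (one_le_M M) (p.1 : Fin d → ℤ) (q.1 : Fin d → ℤ)))

variable (d) in
/-- **KERNEL-CHECKED — B6 (2.152)–(2.157) END-TO-END ON THE WHOLE TORUS FOR THE MATRIX OF THE (1.66) FORM, with NO
representation hypothesis**: d ≥ 2, L ≥ 1, c₀, δ₀ > 0 ⟹ ∃ c, δ > 0 such that for every torus (L ∣ M_i) and every
level n ≥ 1 at which the kernel of Δ = `deltaPol M n` (THE symmetric matrix with ⟨B, ΔB⟩ = the (1.66) form,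
`represents_deltaPol`, unique by `eq_deltaPol_of_represents`) decays with (c₀, δ₀) (`KernelDecay`), the covariance
C^{(k)} = C(C*ΔC)⁻¹C* of (2.156) with the explicit C of p. 250 satisfies |C^{(k)}(b,b′)| ≤ c·e^{−δρ_M(b₋,b′₋)}.
(`cov2156_torus` at Δ = `deltaPol M n`.)  The ONLY printed input not proved is `KernelDecay`.
[cite: Balaban1984PropagatorsII, (2.152)–(2.157) pp.249–250; Balaban1984PropagatorsI, (1.66)–(1.67) p.29] -/
theorem cov2156_torus_deltaPol (hd : 2 ≤ d) (hL : 1 ≤ L) {c₀ δ₀ : ℝ} (hc : 0 < c₀) (hδ : 0 < δ₀) :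
    ∃ c δ : ℝ, 0 < c ∧ 0 < δ ∧
      ∀ (M : Fin d → ℕ) [∀ μ, NeZero (M μ)], (∀ i, L ∣ M i) → ∀ n : ℕ, 1 ≤ n → KernelDecay M n c₀ δ₀ →
        ∀ p q : B4.Idx (pbox M) d, |(bondReductionT L M (deltaPol M n)).cov p q| ≤
          c * Real.exp (-(δ * pdist M (one_le_M M) (p.1 : Fin d → ℤ) (q.1 : Fin d → ℤ))) := by
  obtain ⟨c, δ, hc', hδ', H⟩ := cov2156_torus d (L := L) hd hL hc hδ
  exact ⟨c, δ, hc', hδ', fun M _ hLM n hn hdec p q =>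
    H M hLM n hn (deltaPol M n) (deltaPol_isSymm M n) (represents_deltaPol M n) hdec p q⟩

end Explicit

end

end Literature.MathematicalPhysics.QuantumFieldTheory.Balaban1983to89.B6Cov2156Torus
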